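import Mathlib.Analysis.Normed.Group.Ultra
import Mathlib.Analysis.Normed.Unbundled.SpectralNorm
import Mathlib.Analysis.SpecificLimits.Basic
import Mathlib.FieldTheory.Galois.NormalBasis
import Literature.NumberTheory.GaloisRepresentations.CyclicNormIndex
import Literature.NumberTheory.GaloisRepresentations.LocalExistenceTameProofs
import Literature.NumberTheory.GaloisRepresentations.LocalWeilDatumRelative
import HarnessLib

/-!
# The class field axiom for local fields (Neukirch ANT V (1.1)), proved

Neukirch, *Algebraic Number Theory*, Ch. V §1, Thm. (1.1) (p. 317 of the translation): *for a cyclic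
extension `L|K` of local fields, `#Hⁱ(G(L|K), L*) = [L:K]` for `i = 0` and `= 1` for `i = -1`* —
the **class field axiom** (IV (6.1)) for the multiplicative group of a local field, "the crucial
point" of local class field theory in Neukirch's approach.  This file **proves** it:

* `Literature.NumberTheory.GaloisRepresentations.index_range_unitsMap_norm_eq_finrank` — `i = 0`:
  for a non-archimedean local field `K` (Mathlib `IsNonarchimedeanLocalField`) and `L/K` finite
  Galois with cyclic group, `(Kˣ : N_{L/K} Lˣ) = [L : K]`;
* `Literature.NumberTheory.GaloisRepresentations.exists_eq_apply_div_of_norm_eq_one` — `i = -1`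
  (Hilbert 90, IV (3.5); from `CyclicNormIndex.lean`);
* `Literature.NumberTheory.GaloisRepresentations.LocalWeilDatum.cyclicNormIndexEq_holds` — the
  **discharge of the named fact** `LocalWeilDatum.cyclicNormIndexEq F` of `LocalWeilDatumRelative.lean`
  (the `i = 0` statement for the finite separable subextensions `K ≤ L ⊆ F̄` of a local `F`, the input
  of `LocalWeilDatum.isClassFieldTheory_of_cyclicNormIndexEq`, i.e. of Neukirch's abstract class
  field theory for the local Weil datum);
* `Literature.NumberTheory.GaloisRepresentations.index_range_norm_eq_finrank_of_isCyclic` — the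
  cyclic case of the tree's named fact `index_normSubgroup_eq_finrank` (`LocalExistenceTheorem.lean`,
  Serre XIII §4 Prop. 9), proved;
* `Literature.NumberTheory.GaloisRepresentations.CyclicNormIndex.index_range_norm_eq_finrank_of_normed`
  — the common generalisation actually proved: `K` any complete, locally compact, ultrametric
  normed field with `‖Kˣ‖^d ⊆ ρ^ℤ` for some `0 < ρ < 1 ≤ d` (a local field with `d = 1`; a finite
  extension of one with its spectral norm and `d` the degree).

## Neukirch's proof and its formalisation

Neukirch: `h(G, L*) = h(G, ℤ) h(G, U_L) = [L:K] h(G, U_L)` (IV (7.3)) and `h(G, U_L) = 1`, because for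
a normal basis `{α^σ}`, `α ∈ 𝒪_L`, and `M = ∑ 𝒪_K α^σ` the groups `Vⁿ = 1 + π_Kⁿ M` (`n ≥ N`) are
`G`-stable open subgroups of finite index of `U_L` with `Vⁿ/Vⁿ⁺¹ ≅ M/π_K M = Ind_G(𝒪_K/𝔭_K)`, hence
`Hⁱ(G, Vⁿ/Vⁿ⁺¹) = 1` (IV (7.4)) and, by successive approximation and completeness,
`Hⁱ(G, Vⁿ) = 1`; then Hilbert 90 gives `#H⁰ = h = [L:K]`.  Here:

* §Lattice/§Congr: instead of `α ∈ 𝒪_L` and `n ≥ N` we scale the normal basis `b` (Mathlib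
  `IsGalois.normalBasis`) by `π^t`, `t ≫ 0`, so that its structure constants lie in `π𝒪_K` and
  `‖b_σ‖ < 1` (`exists_scaled_normal_basis`); the filtration `M_r = π^r ⊕ 𝒪_K b_σ`
  (`CyclicNormIndex.latt`, defined by coordinates) then satisfies `M_r M_s ⊆ M_{r+s+1}`, is separated
  and complete (`exists_forall_sub_mem_latt`, from the completeness of `K` coordinatewise), and
  `V_r = 1 + M_r` (`congr`, `congrUnits`) are `G`-stable subgroups of `Lˣ` (inverses by the
  iteration `y ↦ 1 - m y`, `exists_mul_eq_one`).  The ring of integers `𝒪_L` is never needed.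
* §Graded: `H⁰` and `H⁻¹` of `V_r/V_{r+1} ≅ ⊕_G 𝓀` in explicit form (`exists_sum_gal_sub_mem_latt`:
  a `σ`-invariant class has congruent coordinates and is the class of `∑ σ^i (m_1 b_1)`;
  `exists_gal_sub_sub_mem_latt`: a class of coordinate sum `0` is `σu - u` with
  `u = -∑_j (∑_{i≤j} m_{σ^i}) b_{σ^j}`, a telescoping identity), the multiplicative one-step
  lemmas (`exists_div_galNorm_mem_congr`, `exists_div_twist_mem_congr`) and the successive
  approximation `exists_apply_eq_of_step`, giving `H⁰(G, V_r) = 1` (`exists_galNorm_eq`) and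
  `H⁻¹(G, V_r) = 1` (`exists_twist_eq`).
* §Normed: `V_0` is open (coordinates are continuous, finite dimension over complete `K`), elements
  of `V_0` have absolute value `1` so `π^k ∈ V_0 ⇒ k = 0`, and `(Lˣ : V_0 π^ℤ) < ∞`
  (`finite_quotient_congrUnits_sup`): `‖y‖^{[L:K]} = ‖N y‖` puts `‖Lˣ‖^{nd}` in `ρ^ℤ`, so finitely
  many spheres meet every class modulo `π^ℤ`, each a translate of the compact unit sphere
  (`isCompact_sphere_spectralNorm`, local compactness), covered by finitely many translates of `V_0`.
  This replaces `Lˣ/U_L ≅ ℤ` and the finiteness of `U_L/Vⁿ`.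
* §Assembly: the reduction theorem `CyclicNormIndex.index_range_norm_eq_finrank`
  (`CyclicNormIndex.lean`: O'Meara's index form of the Herbrand quotient for the finite-index
  subgroup `V_0 π^ℤ ≤ Lˣ`, plus Hilbert 90) with `V = V_0`, `c = π`.
* §LocalField: a non-archimedean local field with the norm of its valuation
  (`Valued.toNontriviallyNormedField`, `d = 1`, `ρ = ‖π‖` by `exists_valuation_eq_unifValue_zpow`),
  and an intermediate field `K` of `F̄/F` with the spectral norm over `F`
  (`spectralNorm.nontriviallyNormedField`, complete and proper as a finite-dimensional `F`-space,
  `‖x‖^{[K:F]} = ‖N_{K/F} x‖` by the tree's `norm_algebraNorm_eq_spectralNorm_pow`).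

## Generality of the lattice and congruence sections

§Lattice and the first half of §Congr (`latt`, `congr`, `congrUnits` and their closure / inversion /
completeness lemmas, `isUnit_of_mem_congr`, `div_mem_congrUnits_of_sub_mem`, …) are stated for a
normed ultrametric field `K` (`[NormedField K]`) and an arbitrary commutative `K`-algebra `L`
(`[CommRing L]`): nothing there uses that `L` is a field (an element of `V_r` is a unit by the
convergent iteration `y ↦ 1 - m y`).  This is the generality needed by the semi-local algebras
`∏_{w ∣ v} E_w` of the global cyclic norm index computation (`NormalBasisCongruence.lean`,
`SemiLocalUnits.lean`).  The lemmas that divide in `L` (`ne_zero_of_mem_congr`, `inv_mem_congr`,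
`div_mem_congr_of_sub_mem`, `mk0_mem_congrUnits`) are in §CongrField with `[Field L]`.

## References

* J. Neukirch, *Algebraic Number Theory*, Grundlehren 322, Springer 1999 (transl. N. Schappacher):
  Ch. V §1 Thm. (1.1) and its proof (pp. 317–318); Ch. IV §3 (3.5), §6 (6.1), §7 (7.3)–(7.4).
  [NeukirchANT1999]
* J.-P. Serre, *Local Fields*, GTM 67, Springer 1979, Ch. XIII §4 Prop. 9 (the equality for abelian
  extensions, via the reciprocity isomorphism).  [SerreLocalFields1979]

## Mathlib / tree

Mathlib: `IsGalois.normalBasis`, `spectralNorm.nontriviallyNormedField/normedSpace/completeSpace`,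
`spectralNorm_extends`, `isNonarchimedean_spectralNorm`, `LinearMap.continuous_of_finiteDimensional`,
`FiniteDimensional.proper`, `IsUltrametricDist.isOpen_closedBall`, `IsCompact.elim_finite_subcover`,
`cauchySeq_of_le_geometric`, `Valued.toNontriviallyNormedField`, `IsCyclic.exists_generator`.
Tree: `CyclicNormIndex.lean` (reduction theorem, Hilbert 90), `LocalExistenceTheoremProofs.lean`
(`norm_algebraNorm_eq_spectralNorm_pow`, `isCompact_sphere_spectralNorm`), `LocalExistenceLubinTate.lean`
(`exists_isUniformizer`, `exists_valuation_eq_unifValue_zpow`), `LocalWeilDatumRelative.lean`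
(`cyclicNormIndexEq`, `towerAlgebra`; its `LocalWeilDatum.exists_mul_apply_eq_of_norm_eq_one` is
another universe-polymorphic cyclic Hilbert 90, equivalent to `exists_eq_apply_div_of_norm_eq_one`
by `a ↦ a⁻¹`).  Mathlib has no Herbrand quotients of unit groups / norm index computations for
local fields at this pin.
-/

noncomputable section

open Filter Topology

namespace Literature.NumberTheory.GaloisRepresentations

namespace CyclicNormIndex

/-! ### The lattice filtration `M_r = π^r · 𝒪_K⟨b⟩` attached to a basis with small structure constants -/

section Lattice

variable {K : Type*} [NormedField K] [IsUltrametricDist K]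
variable {L : Type*} [CommRing L] [Algebra K L]
variable {ι : Type*} (b : Module.Basis ι K L) (π : K)

/-- `M_r = {x ∈ L : all b-coordinates of x have absolute value ≤ ‖π‖^r}` = `π^r · ⊕ᵢ 𝒪_K bᵢ`
(Neukirch's `π_K^n M`, `M = ∑ 𝒪_K α^σ`), for any commutative `K`-algebra `L` with a basis `b`
over a normed ultrametric field `K` (the semi-local algebras `∏_{w ∣ v} E_w` of
`NormalBasisCongruence.lean` included). [cite: NeukirchANT1999, Ch. V §1 Thm. (1.1) (proof)] -/
def latt (r : ℕ) : AddSubgroup L where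
  carrier := {x | ∀ i, ‖b.repr x i‖ ≤ ‖π‖ ^ r}
  zero_mem' := fun i => by simp
  add_mem' := by
    intro x y hx hy i
    rw [map_add, Finsupp.add_apply]
    exact (IsUltrametricDist.norm_add_le_max _ _).trans (max_le (hx i) (hy i))
  neg_mem' := by
    intro x hx i
    rw [map_neg, Finsupp.neg_apply, norm_neg]
    exact hx i

variable {b π}

/-- Membership in `M_r`. [folklore] -/
theorem mem_latt_iff {r : ℕ} {x : L} : x ∈ latt b π r ↔ ∀ i, ‖b.repr x i‖ ≤ ‖π‖ ^ r := Iff.rfl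

/-- `M_s ⊆ M_r` for `r ≤ s` (as `‖π‖ ≤ 1`). [folklore] -/
theorem latt_antitone (hπ : ‖π‖ ≤ 1) {r s : ℕ} (h : r ≤ s) : latt b π s ≤ latt b π r :=
  fun _ hx i => (hx i).trans (pow_le_pow_of_le_one (norm_nonneg _) hπ h)

/-- `c • M_r ⊆ M_{s+r}` for `‖c‖ ≤ ‖π‖^s`. [folklore] -/
theorem smul_mem_latt {r s : ℕ} {c : K} (hc : ‖c‖ ≤ ‖π‖ ^ s) {x : L} (hx : x ∈ latt b π r) :
    c • x ∈ latt b π (s + r) := by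
  intro i
  rw [map_smul, Finsupp.smul_apply, smul_eq_mul, norm_mul, pow_add]
  exact mul_le_mul hc (hx i) (norm_nonneg _) (by positivity)

/-- `𝒪_K • M_r ⊆ M_r`. [folklore] -/
theorem smul_mem_latt_of_norm_le_one {r : ℕ} {c : K} (hc : ‖c‖ ≤ 1) {x : L} (hx : x ∈ latt b π r) :
    c • x ∈ latt b π r := by
  have := smul_mem_latt (s := 0) (by rwa [pow_zero]) hx
  rwa [zero_add] at this

/-- `π^s • M_r ⊆ M_{s+r}`. [folklore] -/
theorem pow_smul_mem_latt {r : ℕ} (s : ℕ) {x : L} (hx : x ∈ latt b π r) :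
    π ^ s • x ∈ latt b π (s + r) :=
  smul_mem_latt (by rw [norm_pow]) hx

/-- A single basis vector scaled by a small coefficient lies in `M_r`. [folklore] -/
theorem smul_basis_mem_latt [DecidableEq ι] {r : ℕ} {c : K} (hc : ‖c‖ ≤ ‖π‖ ^ r) (i : ι) :
    c • b i ∈ latt b π r := by
  intro j
  rw [map_smul, Finsupp.smul_apply, smul_eq_mul, b.repr_self, Finsupp.single_apply]
  split_ifs
  · rwa [mul_one]
  · rw [mul_zero, norm_zero]; positivity

/-- An element with prescribed coordinates lies in `M_r` iff the coordinates are small. [folklore] -/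
theorem sum_smul_mem_latt_iff [Fintype ι] {r : ℕ} (c : ι → K) :
    ∑ i, c i • b i ∈ latt b π r ↔ ∀ i, ‖c i‖ ≤ ‖π‖ ^ r := by
  simp only [mem_latt_iff, b.repr_sum_self]

omit [IsUltrametricDist K] in
/-- Coordinates of a product: `(xy)_k = ∑_{i,j} x_i y_j c_{ijk}` with the structure constants
`c_{ijk} = (b_i b_j)_k`. [folklore] -/
theorem repr_mul_apply [Fintype ι] (x y : L) (k : ι) :
    b.repr (x * y) k = ∑ i, ∑ j, b.repr x i * b.repr y j * b.repr (b i * b j) k := by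
  conv_lhs => rw [← b.sum_repr x, ← b.sum_repr y, Finset.sum_mul_sum]
  simp only [map_sum, Finsupp.coe_finsetSum, Finset.sum_apply, smul_mul_smul_comm, map_smul,
    Finsupp.smul_apply, smul_eq_mul, mul_assoc]

/-- **`M_r · M_s ⊆ M_{r+s+1}`** when the structure constants lie in `π𝒪_K`
(Neukirch: `(π^n M)(π^n M) ⊆ π^{2n} M M ⊆ … ⊆ π^{n+1}`-type estimate, here arranged by scaling the
normal basis). [cite: NeukirchANT1999, Ch. V §1 Thm. (1.1) (proof)] -/
theorem mul_mem_latt [Fintype ι] (hmul : ∀ i j k, ‖b.repr (b i * b j) k‖ ≤ ‖π‖) {r s : ℕ} {x y : L}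
    (hx : x ∈ latt b π r) (hy : y ∈ latt b π s) : x * y ∈ latt b π (r + s + 1) := by
  intro k
  rw [repr_mul_apply]
  refine IsUltrametricDist.norm_sum_le_of_forall_le_of_nonneg (by positivity) fun i _ => ?_
  refine IsUltrametricDist.norm_sum_le_of_forall_le_of_nonneg (by positivity) fun j _ => ?_
  rw [norm_mul, norm_mul, pow_add, pow_add, pow_one]
  exact mul_le_mul (mul_le_mul (hx i) (hy j) (norm_nonneg _) (by positivity)) (hmul i j k)
    (norm_nonneg _) (by positivity)

/-- `⋂_r M_r = 0` (for `‖π‖ < 1`). [folklore] -/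
theorem eq_zero_of_forall_mem_latt (hπ : ‖π‖ < 1) {x : L} (hx : ∀ r, x ∈ latt b π r) : x = 0 := by
  apply b.repr.injective
  rw [map_zero]
  ext i
  rw [Finsupp.zero_apply, ← norm_le_zero_iff]
  refine ge_of_tendsto (tendsto_pow_atTop_nhds_zero_of_lt_one (norm_nonneg π) hπ) ?_
  exact Filter.Eventually.of_forall fun r => hx r i

/-- **Completeness of the filtration** (from the completeness of `K`, coordinatewise): a sequence
`f` with `f_{k+1} - f_k ∈ M_{r+k}` has a limit `x` with `x - f_k ∈ M_{r+k}` for all `k`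
(Neukirch's "convergent product"). [cite: NeukirchANT1999, Ch. V §1 Thm. (1.1) (proof)] -/
theorem exists_forall_sub_mem_latt [Fintype ι] [CompleteSpace K] (hπ : ‖π‖ < 1) {r : ℕ} {f : ℕ → L}
    (hf : ∀ k, f (k + 1) - f k ∈ latt b π (r + k)) :
    ∃ x : L, ∀ k, x - f k ∈ latt b π (r + k) := by
  have hπ1 : ‖π‖ ≤ 1 := hπ.le
  -- coordinatewise Cauchy sequences
  have key : ∀ i, ∃ y : K, ∀ k, ‖y - b.repr (f k) i‖ ≤ ‖π‖ ^ (r + k) := by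
    intro i
    set u : ℕ → K := fun k => b.repr (f k) i with hu
    have hstep : ∀ k, ‖u (k + 1) - u k‖ ≤ ‖π‖ ^ (r + k) := fun k => by
      have := hf k i
      rwa [map_sub, Finsupp.sub_apply] at this
    have htail : ∀ k m, k ≤ m → ‖u m - u k‖ ≤ ‖π‖ ^ (r + k) := by
      intro k m hkm
      induction m, hkm using Nat.le_induction with
      | base => simp
      | succ m hkm ih =>
        have h1 : u (m + 1) - u k = (u (m + 1) - u m) + (u m - u k) := by ring
        rw [h1]
        refine (IsUltrametricDist.norm_add_le_max _ _).trans (max_le ?_ ih)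
        exact (hstep m).trans (pow_le_pow_of_le_one (norm_nonneg _) hπ1 (by omega))
    have hcauchy : CauchySeq u := by
      refine cauchySeq_of_le_geometric ‖π‖ (‖π‖ ^ r) hπ fun k => ?_
      rw [dist_eq_norm, ← norm_neg, neg_sub, ← pow_add]
      exact hstep k
    obtain ⟨y, hy⟩ := cauchySeq_tendsto_of_complete hcauchy
    refine ⟨y, fun k => ?_⟩
    have hlim : Tendsto (fun m => ‖u m - u k‖) atTop (𝓝 ‖y - u k‖) :=
      (hy.sub tendsto_const_nhds).norm
    exact le_of_tendsto hlim (Filter.eventually_atTop.mpr ⟨k, fun m hm => htail k m hm⟩)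
  choose y hy using key
  refine ⟨∑ i, y i • b i, fun k i => ?_⟩
  rw [map_sub, Finsupp.sub_apply, b.repr_sum_self]
  exact hy i k

end Lattice

/-! ### The congruence subgroups `V_r = 1 + M_r` -/

section Congr

variable {K : Type*} [NormedField K] [IsUltrametricDist K]
variable {L : Type*} [CommRing L] [Algebra K L]
variable {ι : Type*} [Fintype ι] {b : Module.Basis ι K L} {π : K}

variable (b π) in
/-- `V_r = 1 + M_r` (Neukirch's `V^n = 1 + π_K^n M`), as a subset of `L`.
[cite: NeukirchANT1999, Ch. V §1 Thm. (1.1) (proof)] -/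
def congr (r : ℕ) : Set L := {x | x - 1 ∈ latt b π r}

omit [Fintype ι] in
/-- Membership in `V_r`. [folklore] -/
theorem mem_congr_iff {r : ℕ} {x : L} : x ∈ congr b π r ↔ x - 1 ∈ latt b π r := Iff.rfl

omit [Fintype ι] in
/-- `1 ∈ V_r`. [folklore] -/
theorem one_mem_congr (r : ℕ) : (1 : L) ∈ congr b π r := by
  rw [mem_congr_iff, sub_self]; exact zero_mem _

omit [Fintype ι] in
/-- `1 + m ∈ V_r ↔ m ∈ M_r`. [folklore] -/
theorem one_add_mem_congr_iff {r : ℕ} {m : L} : 1 + m ∈ congr b π r ↔ m ∈ latt b π r := by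
  rw [mem_congr_iff, add_sub_cancel_left]

omit [Fintype ι] in
/-- `V_s ⊆ V_r` for `r ≤ s`. [folklore] -/
theorem congr_antitone (hπ : ‖π‖ ≤ 1) {r s : ℕ} (h : r ≤ s) : congr b π s ⊆ congr b π r :=
  fun _ hx => latt_antitone hπ h hx

/-- **`V_r · M_s ⊆ M_s`**: `(1 + m) z = z + m z`. [folklore] -/
theorem mul_mem_latt_of_mem_congr (hmul : ∀ i j k, ‖b.repr (b i * b j) k‖ ≤ ‖π‖) (hπ : ‖π‖ ≤ 1)
    {r s : ℕ} {x z : L} (hx : x ∈ congr b π r) (hz : z ∈ latt b π s) : x * z ∈ latt b π s := by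
  have : x * z = z + (x - 1) * z := by ring
  rw [this]
  exact add_mem hz (latt_antitone hπ (by omega) (mul_mem_latt hmul hx hz))

/-- `V_r` is closed under multiplication: `xy - 1 = x(y-1) + (x-1)`. [cite: NeukirchANT1999, Ch. V §1 Thm. (1.1) (proof)] -/
theorem mul_mem_congr (hmul : ∀ i j k, ‖b.repr (b i * b j) k‖ ≤ ‖π‖) (hπ : ‖π‖ ≤ 1) {r : ℕ}
    {x y : L} (hx : x ∈ congr b π r) (hy : y ∈ congr b π r) : x * y ∈ congr b π r := by
  have : x * y - 1 = x * (y - 1) + (x - 1) := by ring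
  rw [mem_congr_iff, this]
  exact add_mem (mul_mem_latt_of_mem_congr hmul hπ hx hy) hx

/-- Finite products of elements of `V_r` lie in `V_r`. [folklore] -/
theorem prod_mem_congr (hmul : ∀ i j k, ‖b.repr (b i * b j) k‖ ≤ ‖π‖) (hπ : ‖π‖ ≤ 1) {r : ℕ}
    {α : Type*} (s : Finset α) {f : α → L} (hf : ∀ a ∈ s, f a ∈ congr b π r) :
    ∏ a ∈ s, f a ∈ congr b π r := by
  classical
  induction s using Finset.induction_on with
  | empty => rw [Finset.prod_empty]; exact one_mem_congr r
  | insert a s has ih =>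
    rw [Finset.prod_insert has]
    exact mul_mem_congr hmul hπ (hf a (Finset.mem_insert_self a s))
      (ih fun x hx => hf x (Finset.mem_insert_of_mem hx))

/-- **`V_r` is closed under inverses** (Neukirch: `(1 - π^n μ)⁻¹ = 1 + π^n ∑ μ^i π^{n(i-1)} ∈ V^n`;
here by the iteration `y_{k+1} = 1 - m y_k`, convergent by completeness).
[cite: NeukirchANT1999, Ch. V §1 Thm. (1.1) (proof)] -/
theorem exists_mul_eq_one [CompleteSpace K] (hmul : ∀ i j k, ‖b.repr (b i * b j) k‖ ≤ ‖π‖)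
    (hπ : ‖π‖ < 1) {r : ℕ} {x : L} (hx : x ∈ congr b π r) : ∃ y ∈ congr b π r, x * y = 1 := by
  set m := x - 1 with hm
  have hmM : m ∈ latt b π r := hx
  have hx1 : x = 1 + m := by rw [hm]; ring
  let f : ℕ → L := fun k => Nat.rec 1 (fun _ fk => 1 - m * fk) k
  have hf0 : f 0 = 1 := rfl
  have hfs : ∀ k, f (k + 1) = 1 - m * f k := fun k => rfl
  have hdiff : ∀ k, f (k + 1) - f k ∈ latt b π (r + k) := by
    intro k
    induction k with
    | zero =>
      rw [hfs, hf0, mul_one, sub_sub_cancel_left, add_zero]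
      exact neg_mem hmM
    | succ k ih =>
      have : f (k + 1 + 1) - f (k + 1) = -(m * (f (k + 1) - f k)) := by rw [hfs (k + 1), hfs k]; ring
      rw [this]
      exact neg_mem (latt_antitone hπ.le (by omega) (mul_mem_latt hmul hmM ih))
  obtain ⟨y, hy⟩ := exists_forall_sub_mem_latt hπ hdiff
  have hyV : y ∈ congr b π r := by have := hy 0; rwa [hf0, add_zero] at this
  refine ⟨y, hyV, ?_⟩
  have hxf : ∀ k, x * f k - 1 = -(f (k + 1) - f k) := fun k => by rw [hfs, hx1]; ring
  have key : ∀ k, x * y - 1 ∈ latt b π (r + k) := fun k => by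
    have : x * y - 1 = x * (y - f k) + (x * f k - 1) := by ring
    rw [this, hxf]
    exact add_mem (mul_mem_latt_of_mem_congr hmul hπ.le hx (hy k)) (neg_mem (hdiff k))
  have h0 : x * y - 1 = 0 :=
    eq_zero_of_forall_mem_latt hπ fun k => latt_antitone hπ.le (by omega : k ≤ r + k) (key k)
  exact sub_eq_zero.mp h0

/-- Conversely `a ∈ V_r`, `u ∈ V_s` give `a u - a ∈ M_s`. [folklore] -/
theorem mul_sub_mem_latt (hmul : ∀ i j k, ‖b.repr (b i * b j) k‖ ≤ ‖π‖) (hπ : ‖π‖ ≤ 1)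
    {r s : ℕ} {a u : L} (ha : a ∈ congr b π r) (hu : u ∈ congr b π s) : a * u - a ∈ latt b π s := by
  have : a * u - a = a * (u - 1) := by ring
  rw [this]
  exact mul_mem_latt_of_mem_congr hmul hπ ha hu

/-- Elements of `V_r` are units (of the commutative ring `L`). [folklore] -/
theorem isUnit_of_mem_congr [CompleteSpace K] (hmul : ∀ i j k, ‖b.repr (b i * b j) k‖ ≤ ‖π‖)
    (hπ : ‖π‖ < 1) {r : ℕ} {x : L} (hx : x ∈ congr b π r) : IsUnit x := by
  obtain ⟨y, -, hxy⟩ := exists_mul_eq_one hmul hπ hx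
  exact IsUnit.of_mul_eq_one y hxy

/-- Products `∏ (1 + z_a)` with `z_a ∈ M_r` agree with `1 + ∑ z_a` modulo `M_{2r+1}`.
[folklore] -/
theorem prod_one_add_sub_mem_latt (hmul : ∀ i j k, ‖b.repr (b i * b j) k‖ ≤ ‖π‖) (hπ : ‖π‖ ≤ 1)
    {r : ℕ} {α : Type*} (s : Finset α) {z : α → L} (hz : ∀ a ∈ s, z a ∈ latt b π r) :
    (∏ a ∈ s, (1 + z a)) - (1 + ∑ a ∈ s, z a) ∈ latt b π (r + r + 1) := by
  classical
  induction s using Finset.induction_on with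
  | empty => simp
  | insert a s has ih =>
    have hza : z a ∈ latt b π r := hz a (Finset.mem_insert_self a s)
    have hz' : ∀ x ∈ s, z x ∈ latt b π r := fun x hx => hz x (Finset.mem_insert_of_mem hx)
    have hS : ∑ x ∈ s, z x ∈ latt b π r := sum_mem hz'
    set E := (∏ x ∈ s, (1 + z x)) - (1 + ∑ x ∈ s, z x) with hE
    have hE' : E ∈ latt b π (r + r + 1) := ih hz'
    rw [Finset.prod_insert has, Finset.sum_insert has]
    have : (1 + z a) * ∏ x ∈ s, (1 + z x) - (1 + (z a + ∑ x ∈ s, z x)) =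
        E + z a * (∑ x ∈ s, z x) + z a * E := by rw [hE]; ring
    rw [this]
    refine add_mem (add_mem hE' (mul_mem_latt hmul hza hS)) ?_
    exact latt_antitone hπ (by omega) (mul_mem_latt hmul hza hE')

/-- `1 + c · ∑_i b_i ∈ V_r` for `‖c‖ ≤ ‖π‖^r`. [folklore] -/
theorem one_add_smul_sum_mem_congr {r : ℕ} {c : K} (hc : ‖c‖ ≤ ‖π‖ ^ r) :
    1 + c • ∑ i : ι, b i ∈ congr b π r := by
  classical
  rw [one_add_mem_congr_iff, Finset.smul_sum]
  exact sum_mem fun i _ => smul_basis_mem_latt hc i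

variable (b π) in
/-- `V_r` as a subgroup of `Lˣ` (its elements are units by `exists_mul_eq_one`).
[cite: NeukirchANT1999, Ch. V §1 Thm. (1.1) (proof)] -/
def congrUnits [CompleteSpace K] (hmul : ∀ i j k, ‖b.repr (b i * b j) k‖ ≤ ‖π‖) (hπ : ‖π‖ < 1)
    (r : ℕ) : Subgroup Lˣ where
  carrier := {u | (u : L) ∈ congr b π r}
  one_mem' := by simpa using one_mem_congr r
  mul_mem' := fun hu hv => by simpa using mul_mem_congr hmul hπ.le hu hv
  inv_mem' := by
    intro u hu
    obtain ⟨y, hy, huy⟩ := exists_mul_eq_one hmul hπ hu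
    have : ((u⁻¹ : Lˣ) : L) = y :=
      calc ((u⁻¹ : Lˣ) : L) = (u⁻¹ : Lˣ) * ((u : L) * y) := by rw [huy, mul_one]
        _ = y := by rw [← mul_assoc, Units.inv_mul, one_mul]
    show ((u⁻¹ : Lˣ) : L) ∈ congr b π r
    rw [this]
    exact hy

/-- Membership in `V_r ≤ Lˣ`. [folklore] -/
theorem mem_congrUnits_iff [CompleteSpace K] (hmul : ∀ i j k, ‖b.repr (b i * b j) k‖ ≤ ‖π‖)
    (hπ : ‖π‖ < 1) {r : ℕ} {u : Lˣ} : u ∈ congrUnits b π hmul hπ r ↔ (u : L) ∈ congr b π r :=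
  Iff.rfl

/-- The unit defined by an element of `V_r` lies in `V_r`. [folklore] -/
theorem unit_mem_congrUnits [CompleteSpace K] (hmul : ∀ i j k, ‖b.repr (b i * b j) k‖ ≤ ‖π‖)
    (hπ : ‖π‖ < 1) {r : ℕ} {x : L} (hx : x ∈ congr b π r) :
    (isUnit_of_mem_congr hmul hπ hx).unit ∈ congrUnits b π hmul hπ r := by
  rw [mem_congrUnits_iff, IsUnit.unit_spec]
  exact hx

/-- `V_s ≤ V_r` for `r ≤ s`. [folklore] -/
theorem congrUnits_antitone [CompleteSpace K] (hmul : ∀ i j k, ‖b.repr (b i * b j) k‖ ≤ ‖π‖)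
    (hπ : ‖π‖ < 1) {r s : ℕ} (h : r ≤ s) : congrUnits b π hmul hπ s ≤ congrUnits b π hmul hπ r :=
  fun _ hu => congr_antitone hπ.le h hu

/-- **Division lemma** in `Lˣ`: if `a ∈ V_r` and `a' - a ∈ M_s` then `a'/a ∈ V_s`
(`a'/a - 1 = a⁻¹ (a' - a)`). [folklore] -/
theorem div_mem_congrUnits_of_sub_mem [CompleteSpace K]
    (hmul : ∀ i j k, ‖b.repr (b i * b j) k‖ ≤ ‖π‖) (hπ : ‖π‖ < 1) {r s : ℕ} {a a' : Lˣ}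
    (ha : a ∈ congrUnits b π hmul hπ r) (h : (a' : L) - a ∈ latt b π s) :
    a' / a ∈ congrUnits b π hmul hπ s := by
  have hainv : ((a⁻¹ : Lˣ) : L) ∈ congr b π r := (congrUnits b π hmul hπ r).inv_mem ha
  have : ((a' / a : Lˣ) : L) - 1 = (a⁻¹ : Lˣ) * ((a' : L) - a) := by
    rw [div_eq_mul_inv, Units.val_mul, mul_sub, Units.inv_mul]; ring
  show ((a' / a : Lˣ) : L) - 1 ∈ latt b π s
  rw [this]
  exact mul_mem_latt_of_mem_congr hmul hπ.le hainv h

/-- Conversely `a ∈ V_r`, `u ∈ V_s` give `a u - a ∈ M_s` (units version). [folklore] -/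
theorem val_mul_sub_val_mem_latt [CompleteSpace K] (hmul : ∀ i j k, ‖b.repr (b i * b j) k‖ ≤ ‖π‖)
    (hπ : ‖π‖ < 1) {r s : ℕ} {a u : Lˣ} (ha : a ∈ congrUnits b π hmul hπ r)
    (hu : u ∈ congrUnits b π hmul hπ s) : ((a * u : Lˣ) : L) - a ∈ latt b π s := by
  rw [Units.val_mul]
  exact mul_sub_mem_latt hmul hπ.le ha hu

end Congr

/-! ### The congruence subgroups in a field: inverses and `Units.mk0` -/

section CongrField

variable {K : Type*} [NormedField K] [IsUltrametricDist K]
variable {L : Type*} [Field L] [Algebra K L]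
variable {ι : Type*} [Fintype ι] {b : Module.Basis ι K L} {π : K}

/-- Elements of `V_r` are non-zero. [folklore] -/
theorem ne_zero_of_mem_congr [CompleteSpace K] (hmul : ∀ i j k, ‖b.repr (b i * b j) k‖ ≤ ‖π‖)
    (hπ : ‖π‖ < 1) {r : ℕ} {x : L} (hx : x ∈ congr b π r) : x ≠ 0 := by
  obtain ⟨y, -, hxy⟩ := exists_mul_eq_one hmul hπ hx
  exact left_ne_zero_of_mul_eq_one hxy

/-- `V_r` is closed under inversion in `L`. [cite: NeukirchANT1999, Ch. V §1 Thm. (1.1) (proof)] -/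
theorem inv_mem_congr [CompleteSpace K] (hmul : ∀ i j k, ‖b.repr (b i * b j) k‖ ≤ ‖π‖)
    (hπ : ‖π‖ < 1) {r : ℕ} {x : L} (hx : x ∈ congr b π r) : x⁻¹ ∈ congr b π r := by
  obtain ⟨y, hy, hxy⟩ := exists_mul_eq_one hmul hπ hx
  rwa [inv_eq_of_mul_eq_one_right hxy]

/-- **Division lemma**: if `a ∈ V_r` and `a' - a ∈ M_s` then `a'/a ∈ V_s`
(`a'/a - 1 = a⁻¹ (a' - a)`). [folklore] -/
theorem div_mem_congr_of_sub_mem [CompleteSpace K] (hmul : ∀ i j k, ‖b.repr (b i * b j) k‖ ≤ ‖π‖)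
    (hπ : ‖π‖ < 1) {r s : ℕ} {a a' : L} (ha : a ∈ congr b π r) (h : a' - a ∈ latt b π s) :
    a' / a ∈ congr b π s := by
  have ha0 := ne_zero_of_mem_congr hmul hπ ha
  have : a' / a - 1 = a⁻¹ * (a' - a) := by field_simp
  rw [mem_congr_iff, this]
  exact mul_mem_latt_of_mem_congr hmul hπ.le (inv_mem_congr hmul hπ ha) h

/-- The unit defined by an element of `V_r`. [folklore] -/
theorem mk0_mem_congrUnits [CompleteSpace K] (hmul : ∀ i j k, ‖b.repr (b i * b j) k‖ ≤ ‖π‖)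
    (hπ : ‖π‖ < 1) {r : ℕ} {x : L} (hx : x ∈ congr b π r) :
    Units.mk0 x (ne_zero_of_mem_congr hmul hπ hx) ∈ congrUnits b π hmul hπ r :=
  hx

end CongrField

/-! ### The Galois action in a normal basis -/

section NormalBasis

variable {K : Type*} [NontriviallyNormedField K] [IsUltrametricDist K]
variable {L : Type*} [Field L] [Algebra K L] [FiniteDimensional K L]
variable {b : Module.Basis (L ≃ₐ[K] L) K L} {π : K}

omit [IsUltrametricDist K] [FiniteDimensional K L] in
/-- For a basis of normal shape (`b_g = g(b_1)`), `g(b_j) = b_{gj}`. [folklore] -/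
theorem gal_apply_basis (hb : ∀ g : L ≃ₐ[K] L, b g = g (b 1)) (g j : L ≃ₐ[K] L) :
    g (b j) = b (g * j) := by
  rw [hb j, hb (g * j), AlgEquiv.mul_apply]

omit [IsUltrametricDist K] in
/-- **The Galois group permutes the coordinates**: `(g x)_i = x_{g⁻¹ i}` in a normal basis.
[cite: NeukirchANT1999, Ch. V §1 Thm. (1.1) (proof)] -/
theorem repr_gal_apply (hb : ∀ g : L ≃ₐ[K] L, b g = g (b 1)) (g : L ≃ₐ[K] L) (x : L)
    (i : L ≃ₐ[K] L) : b.repr (g x) i = b.repr x (g⁻¹ * i) := by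
  have hx : g x = ∑ j, b.repr x (g⁻¹ * j) • b j := by
    conv_lhs => rw [← b.sum_repr x]
    rw [map_sum]
    simp_rw [map_smul, gal_apply_basis hb]
    exact Fintype.sum_equiv (Equiv.mulLeft g) _ _ (fun j => by simp)
  rw [hx, b.repr_sum_self]

/-- `M_r` is Galois stable. [cite: NeukirchANT1999, Ch. V §1 Thm. (1.1) (proof)] -/
theorem gal_apply_mem_latt (hb : ∀ g : L ≃ₐ[K] L, b g = g (b 1)) (g : L ≃ₐ[K] L) {r : ℕ} {x : L}
    (hx : x ∈ latt b π r) : g x ∈ latt b π r := fun i => by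
  rw [repr_gal_apply hb]; exact hx _

/-- `V_r` is Galois stable. [cite: NeukirchANT1999, Ch. V §1 Thm. (1.1) (proof)] -/
theorem gal_apply_mem_congr (hb : ∀ g : L ≃ₐ[K] L, b g = g (b 1)) (g : L ≃ₐ[K] L) {r : ℕ} {x : L}
    (hx : x ∈ congr b π r) : g x ∈ congr b π r := by
  rw [mem_congr_iff, ← map_one g, ← map_sub]
  exact gal_apply_mem_latt hb g hx

end NormalBasis

/-! ### Sums over a cyclic Galois group; the norm operator on `L` -/

section GalNorm

variable {K : Type*} [Field K] {L : Type*} [Field L] [Algebra K L]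

/-- Additive companion of `CyclicNormIndex.prod_range_card_pow_eq_prod`: sums over `G = ⟨σ⟩` are
sums over `i < #G` of the values at `σ^i`. [folklore] -/
theorem sum_range_card_pow_eq_sum {G M : Type*} [Group G] [Fintype G] [AddCommMonoid M] {σ : G}
    (hσ : ∀ τ : G, τ ∈ Subgroup.zpowers σ) (f : G → M) :
    ∑ i ∈ Finset.range (Nat.card G), f (σ ^ i) = ∑ g, f g := by
  classical
  have ho : orderOf σ = Nat.card G := orderOf_eq_card_of_forall_mem_zpowers hσ
  have hinj : ∀ i ∈ Finset.range (Nat.card G), ∀ j ∈ Finset.range (Nat.card G),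
      σ ^ i = σ ^ j → i = j := by
    intro i hi j hj h
    rw [Finset.mem_range, ← ho] at hi hj
    exact pow_injOn_Iio_orderOf (Set.mem_Iio.mpr hi) (Set.mem_Iio.mpr hj) h
  have himg : (Finset.range (Nat.card G)).image (fun i => σ ^ i) = Finset.univ := by
    apply Finset.eq_univ_of_card
    rw [Finset.card_image_of_injOn (fun i hi j hj h => hinj i hi j hj h), Finset.card_range,
      Nat.card_eq_fintype_card]
  rw [← himg, Finset.sum_image hinj]

/-- The inverse of a generator generates. [folklore] -/
theorem forall_mem_zpowers_inv {G : Type*} [Group G] {σ : G} (hσ : ∀ τ : G, τ ∈ Subgroup.zpowers σ)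
    (τ : G) : τ ∈ Subgroup.zpowers σ⁻¹ := by
  rw [Subgroup.zpowers_inv]; exact hσ τ

/-- Every element of `G = ⟨σ⟩` (finite) is a natural power of `σ`. [folklore] -/
theorem exists_pow_eq_of_forall_mem_zpowers {G : Type*} [Group G] [Finite G] {σ : G}
    (hσ : ∀ τ : G, τ ∈ Subgroup.zpowers σ) (g : G) : ∃ k : ℕ, σ ^ k = g :=
  (Submonoid.mem_powers_iff _ _).mp (mem_powers_iff_mem_zpowers.mpr (hσ g))

variable (σ : L ≃ₐ[K] L) (n : ℕ)

/-- The norm operator `N x = ∏_{i<n} σ^i x` on `L` (Neukirch's `N_G`). [cite: NeukirchANT1999, Ch. IV §7 (p. 310)] -/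
def galNorm (x : L) : L := ∏ i ∈ Finset.range n, (σ ^ i) x

/-- `N (xy) = N x · N y`. [folklore] -/
theorem galNorm_mul (x y : L) : galNorm σ n (x * y) = galNorm σ n x * galNorm σ n y := by
  simp only [galNorm, map_mul, Finset.prod_mul_distrib]

/-- `N (x/y) = N x / N y`. [folklore] -/
theorem galNorm_div (x y : L) : galNorm σ n (x / y) = galNorm σ n x / galNorm σ n y := by
  simp only [galNorm, map_div₀, Finset.prod_div_distrib]

/-- `N 1 = 1`. [folklore] -/
@[simp] theorem galNorm_one : galNorm σ n 1 = 1 := by simp [galNorm]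

variable {σ n}

/-- `N x = N_{L/K}(x)` for `n = #G`. [cite: NeukirchANT1999, Ch. IV §7 (p. 310)] -/
theorem galNorm_eq_algebraMap_norm [FiniteDimensional K L] [IsGalois K L]
    (hσ : ∀ τ : L ≃ₐ[K] L, τ ∈ Subgroup.zpowers σ) (x : L) :
    galNorm σ (Nat.card (L ≃ₐ[K] L)) x = algebraMap K L (Algebra.norm K x) := by
  rw [galNorm, Algebra.norm_eq_prod_automorphisms, prod_range_card_pow_eq_prod hσ (fun g => g x)]

/-- `N x` is fixed by every element of `G`. [folklore] -/
theorem gal_galNorm [FiniteDimensional K L] [IsGalois K L]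
    (hσ : ∀ τ : L ≃ₐ[K] L, τ ∈ Subgroup.zpowers σ) (g : L ≃ₐ[K] L) (x : L) :
    g (galNorm σ (Nat.card (L ≃ₐ[K] L)) x) = galNorm σ (Nat.card (L ≃ₐ[K] L)) x := by
  rw [galNorm_eq_algebraMap_norm hσ, AlgEquiv.commutes]

/-- `N (g x) = N x`. [folklore] -/
theorem galNorm_gal [FiniteDimensional K L] [IsGalois K L]
    (hσ : ∀ τ : L ≃ₐ[K] L, τ ∈ Subgroup.zpowers σ) (g : L ≃ₐ[K] L) (x : L) :
    galNorm σ (Nat.card (L ≃ₐ[K] L)) (g x) = galNorm σ (Nat.card (L ≃ₐ[K] L)) x := by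
  rw [galNorm_eq_algebraMap_norm hσ, galNorm_eq_algebraMap_norm hσ, Algebra.norm_eq_of_algEquiv]

/-- `N x = 0 ↔ x = 0` (for `n = #G`). [folklore] -/
theorem galNorm_eq_zero_iff [FiniteDimensional K L] [IsGalois K L]
    (hσ : ∀ τ : L ≃ₐ[K] L, τ ∈ Subgroup.zpowers σ) {x : L} :
    galNorm σ (Nat.card (L ≃ₐ[K] L)) x = 0 ↔ x = 0 := by
  rw [galNorm_eq_algebraMap_norm hσ, map_eq_zero, Algebra.norm_eq_zero_iff]

end GalNorm

/-! ### The graded pieces `V_r/V_{r+1} ≅ ⊕_G 𝓀` are cohomologically trivial -/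

section Graded

variable {K : Type*} [NontriviallyNormedField K] [IsUltrametricDist K]
variable {L : Type*} [Field L] [Algebra K L] [FiniteDimensional K L]
variable {b : Module.Basis (L ≃ₐ[K] L) K L} {π : K} {σ : L ≃ₐ[K] L}

local notation "n" => Nat.card (L ≃ₐ[K] L)

/-- **`H⁰` of the graded piece** (`M_r/M_{r+1} = Ind_G(𝒪/π)` has `H⁰ = 1`, Neukirch IV (7.4)): if
`m ∈ M_r` is `σ`-invariant modulo `M_{r+1}` then `m ≡ ∑_{i<n} σ^i m₀ (mod M_{r+1})` for some
`m₀ ∈ M_r` (namely `m₀ = m_1 · b_1`: all coordinates of `m` are congruent).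
[cite: NeukirchANT1999, Ch. V §1 Thm. (1.1) (proof); Ch. IV §7 Prop. (7.4)] -/
theorem exists_sum_gal_sub_mem_latt (hb : ∀ g : L ≃ₐ[K] L, b g = g (b 1))
    (hσ : ∀ τ : L ≃ₐ[K] L, τ ∈ Subgroup.zpowers σ) {r : ℕ} {m : L} (hm : m ∈ latt b π r)
    (hfix : σ m - m ∈ latt b π (r + 1)) :
    ∃ m₀ ∈ latt b π r, (∑ i ∈ Finset.range n, (σ ^ i) m₀) - m ∈ latt b π (r + 1) := by
  classical
  set c : K := b.repr m 1 with hc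
  refine ⟨c • b 1, smul_basis_mem_latt (hm 1) 1, ?_⟩
  -- `∑ σ^i (c b_1) = ∑_g c b_g`
  have hsum : ∑ i ∈ Finset.range n, (σ ^ i) (c • b 1) = ∑ g : L ≃ₐ[K] L, c • b g := by
    rw [← sum_range_card_pow_eq_sum hσ (fun g => c • b g)]
    refine Finset.sum_congr rfl fun i _ => ?_
    rw [map_smul, gal_apply_basis hb, mul_one]
  -- all coordinates of `m` are congruent to `c` modulo `π^{r+1}`
  have hstep : ∀ i, ‖b.repr m (σ⁻¹ * i) - b.repr m i‖ ≤ ‖π‖ ^ (r + 1) := fun i => by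
    have := hfix i
    rwa [map_sub, Finsupp.sub_apply, repr_gal_apply hb] at this
  have hchain : ∀ (k : ℕ) (i : L ≃ₐ[K] L), ‖b.repr m (σ⁻¹ ^ k * i) - b.repr m i‖ ≤ ‖π‖ ^ (r + 1) := by
    intro k
    induction k with
    | zero => intro i; simp
    | succ k ih =>
      intro i
      have h1 : b.repr m (σ⁻¹ ^ (k + 1) * i) - b.repr m i =
          (b.repr m (σ⁻¹ * (σ⁻¹ ^ k * i)) - b.repr m (σ⁻¹ ^ k * i)) +
            (b.repr m (σ⁻¹ ^ k * i) - b.repr m i) := by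
        rw [pow_succ', mul_assoc]; ring
      rw [h1]
      exact (IsUltrametricDist.norm_add_le_max _ _).trans (max_le (hstep _) (ih i))
  have hall : ∀ g : L ≃ₐ[K] L, ‖c - b.repr m g‖ ≤ ‖π‖ ^ (r + 1) := fun g => by
    obtain ⟨k, hk⟩ := exists_pow_eq_of_forall_mem_zpowers (forall_mem_zpowers_inv hσ) g
    have := hchain k 1
    rw [mul_one, hk] at this
    rwa [norm_sub_rev]
  -- conclude coordinatewise
  rw [hsum]
  have hm' : ∑ g, c • b g - m = ∑ g, (c - b.repr m g) • b g := by
    simp_rw [sub_smul, Finset.sum_sub_distrib, b.sum_repr]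
  rw [hm']
  exact (sum_smul_mem_latt_iff _).mpr hall

omit [IsUltrametricDist K] [FiniteDimensional K L] in
/-- The telescoping identity behind `H⁻¹` of the graded piece: with `c_j = ∑_{i≤j} μ_i`,
`∑_{j<N} c_j e_j - ∑_{j<N} c_j e_{j+1} = ∑_{j<N} μ_j e_j - (∑_{i<N} μ_i) e_N`. [folklore] -/
theorem telescope_identity {M : Type*} [AddCommGroup M] [Module K M] (μ : ℕ → K) (e : ℕ → M)
    (N : ℕ) :
    (∑ j ∈ Finset.range N, (∑ i ∈ Finset.range (j + 1), μ i) • e j) -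
        ∑ j ∈ Finset.range N, (∑ i ∈ Finset.range (j + 1), μ i) • e (j + 1) =
      (∑ j ∈ Finset.range N, μ j • e j) - (∑ i ∈ Finset.range N, μ i) • e N := by
  induction N with
  | zero => simp
  | succ N ih =>
    rw [Finset.sum_range_succ (fun j => (∑ i ∈ Finset.range (j + 1), μ i) • e j),
      Finset.sum_range_succ (fun j => (∑ i ∈ Finset.range (j + 1), μ i) • e (j + 1)),
      Finset.sum_range_succ (fun j => μ j • e j), Finset.sum_range_succ μ]
    have h := ih
    rw [sub_eq_iff_eq_add] at h
    rw [h]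
    module

/-- **`H⁻¹` of the graded piece** (`Ind_G` has `H⁻¹ = 1`, Neukirch IV (7.4)): if `m ∈ M_r` has
coordinate sum `≡ 0 (mod π^{r+1})` then `m ≡ σu - u (mod M_{r+1})` for some `u ∈ M_r`
(`u = -∑_j (∑_{i≤j} m_{σ^i}) b_{σ^j}`; exactly `σu - u = m - (∑_g m_g) b_1`).
[cite: NeukirchANT1999, Ch. V §1 Thm. (1.1) (proof); Ch. IV §7 Prop. (7.4)] -/
theorem exists_gal_sub_sub_mem_latt (hb : ∀ g : L ≃ₐ[K] L, b g = g (b 1))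
    (hσ : ∀ τ : L ≃ₐ[K] L, τ ∈ Subgroup.zpowers σ) {r : ℕ} {m : L} (hm : m ∈ latt b π r)
    (hs : ‖∑ g, b.repr m g‖ ≤ ‖π‖ ^ (r + 1)) :
    ∃ u ∈ latt b π r, (σ u - u) - m ∈ latt b π (r + 1) := by
  classical
  set μ : ℕ → K := fun i => b.repr m (σ ^ i) with hμ
  set e : ℕ → L := fun j => b (σ ^ j) with he
  set cs : ℕ → K := fun j => ∑ i ∈ Finset.range (j + 1), μ i with hcs
  set u : L := -∑ j ∈ Finset.range n, cs j • e j with hu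
  have hμle : ∀ i, ‖μ i‖ ≤ ‖π‖ ^ r := fun i => hm _
  have hcsle : ∀ j, ‖cs j‖ ≤ ‖π‖ ^ r := fun j =>
    IsUltrametricDist.norm_sum_le_of_forall_le_of_nonneg (by positivity) fun i _ => hμle i
  refine ⟨u, ?_, ?_⟩
  · rw [hu]
    refine neg_mem (sum_mem fun j _ => smul_basis_mem_latt (hcsle j) _)
  · -- `σ u - u = m - s • b 1`
    have hσe : ∀ j, σ (e j) = e (j + 1) := fun j => by
      simp only [he]; rw [gal_apply_basis hb, ← pow_succ']
    have hσu : σ u = -∑ j ∈ Finset.range n, cs j • e (j + 1) := by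
      rw [hu, map_neg, map_sum]
      simp_rw [map_smul, hσe]
    have htel := telescope_identity (K := K) μ e n
    have hen : e n = b 1 := by simp only [he]; rw [pow_card_eq_one']
    have hsumμ : ∑ i ∈ Finset.range n, μ i = ∑ g, b.repr m g :=
      sum_range_card_pow_eq_sum hσ (fun g => b.repr m g)
    have hsumm : ∑ j ∈ Finset.range n, μ j • e j = m := by
      simp only [hμ, he]
      rw [sum_range_card_pow_eq_sum hσ (fun g => b.repr m g • b g), b.sum_repr]
    have key : σ u - u - m = -((∑ g, b.repr m g) • b 1) := by
      rw [hσu, hu]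
      have : -(∑ j ∈ Finset.range n, cs j • e (j + 1)) - -(∑ j ∈ Finset.range n, cs j • e j) =
          (∑ j ∈ Finset.range n, cs j • e j) - ∑ j ∈ Finset.range n, cs j • e (j + 1) := by abel
      rw [this, htel, hen, hsumμ, hsumm]
      abel
    rw [key]
    exact neg_mem (smul_basis_mem_latt hs 1)

/-- `N(1 + m) ≡ 1 + ∑ σ^i m (mod M_{2r+1})` for `m ∈ M_r`. [folklore] -/
theorem galNorm_one_add_sub_mem_latt (hb : ∀ g : L ≃ₐ[K] L, b g = g (b 1))
    (hmul : ∀ i j k, ‖b.repr (b i * b j) k‖ ≤ ‖π‖) (hπ : ‖π‖ ≤ 1) {r : ℕ} {m : L}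
    (hm : m ∈ latt b π r) (N : ℕ) :
    galNorm σ N (1 + m) - (1 + ∑ i ∈ Finset.range N, (σ ^ i) m) ∈ latt b π (r + r + 1) := by
  have : galNorm σ N (1 + m) = ∏ i ∈ Finset.range N, (1 + (σ ^ i) m) := by
    simp only [galNorm, map_add, map_one]
  rw [this]
  exact prod_one_add_sub_mem_latt hmul hπ _ fun i _ => gal_apply_mem_latt hb _ hm

/-- `N` preserves each `V_s`. [folklore] -/
theorem galNorm_mem_congr (hb : ∀ g : L ≃ₐ[K] L, b g = g (b 1))
    (hmul : ∀ i j k, ‖b.repr (b i * b j) k‖ ≤ ‖π‖) (hπ : ‖π‖ ≤ 1) {s : ℕ} {x : L}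
    (hx : x ∈ congr b π s) (N : ℕ) : galNorm σ N x ∈ congr b π s :=
  prod_mem_congr hmul hπ _ fun _ _ => gal_apply_mem_congr hb _ hx

/-- **`H⁰` step**: a `σ`-fixed `x ∈ V_r` is a norm from `V_r` up to `V_{r+1}`.
[cite: NeukirchANT1999, Ch. V §1 Thm. (1.1) (proof)] -/
theorem exists_div_galNorm_mem_congr [CompleteSpace K] (hb : ∀ g : L ≃ₐ[K] L, b g = g (b 1))
    (hσ : ∀ τ : L ≃ₐ[K] L, τ ∈ Subgroup.zpowers σ)
    (hmul : ∀ i j k, ‖b.repr (b i * b j) k‖ ≤ ‖π‖) (hπ : ‖π‖ < 1) {r : ℕ} {x : L}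
    (hx : x ∈ congr b π r) (hfix : σ x = x) :
    ∃ w ∈ congr b π r, x / galNorm σ n w ∈ congr b π (r + 1) := by
  set m := x - 1 with hm
  have hmM : m ∈ latt b π r := hx
  have hx1 : x = 1 + m := by rw [hm]; ring
  have hfix' : σ m - m ∈ latt b π (r + 1) := by
    have : σ m - m = 0 := by rw [hm, map_sub, map_one, hfix]; ring
    rw [this]; exact zero_mem _
  obtain ⟨m₀, hm₀, hdiff⟩ := exists_sum_gal_sub_mem_latt hb hσ hmM hfix'
  refine ⟨1 + m₀, one_add_mem_congr_iff.mpr hm₀, ?_⟩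
  have hNw : galNorm σ n (1 + m₀) ∈ congr b π r :=
    galNorm_mem_congr hb hmul hπ.le (one_add_mem_congr_iff.mpr hm₀) _
  refine div_mem_congr_of_sub_mem hmul hπ hNw ?_
  -- `x - N w = -( (N w - (1 + ∑ σ^i m₀)) + ((∑ σ^i m₀) - m) )`
  have h1 := galNorm_one_add_sub_mem_latt (σ := σ) hb hmul hπ.le hm₀ n
  have : x - galNorm σ n (1 + m₀) =
      -((galNorm σ n (1 + m₀) - (1 + ∑ i ∈ Finset.range n, (σ ^ i) m₀)) +
        ((∑ i ∈ Finset.range n, (σ ^ i) m₀) - m)) := by rw [hx1]; ring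
  rw [this]
  exact neg_mem (add_mem (latt_antitone hπ.le (by omega) h1) hdiff)

omit [IsUltrametricDist K] in
/-- The coordinate at `1` of `∑_{i<n} σ^i m` is the coordinate sum of `m`. [folklore] -/
theorem repr_sum_gal_one (hb : ∀ g : L ≃ₐ[K] L, b g = g (b 1))
    (hσ : ∀ τ : L ≃ₐ[K] L, τ ∈ Subgroup.zpowers σ) (m : L) :
    b.repr (∑ i ∈ Finset.range n, (σ ^ i) m) 1 = ∑ g, b.repr m g := by
  rw [map_sum, Finsupp.coe_finsetSum, Finset.sum_apply]
  simp_rw [repr_gal_apply hb, mul_one, ← inv_pow]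
  exact sum_range_card_pow_eq_sum (forall_mem_zpowers_inv hσ) (fun g => b.repr m g)

/-- **`H⁻¹` step**: a norm-one `x ∈ V_r` is `σw/w`, `w ∈ V_r`, up to `V_{r+1}`.
[cite: NeukirchANT1999, Ch. V §1 Thm. (1.1) (proof)] -/
theorem exists_div_twist_mem_congr [CompleteSpace K] (hb : ∀ g : L ≃ₐ[K] L, b g = g (b 1))
    (hσ : ∀ τ : L ≃ₐ[K] L, τ ∈ Subgroup.zpowers σ)
    (hmul : ∀ i j k, ‖b.repr (b i * b j) k‖ ≤ ‖π‖) (hπ : ‖π‖ < 1) {r : ℕ} {x : L}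
    (hx : x ∈ congr b π r) (hN : galNorm σ n x = 1) :
    ∃ w ∈ congr b π r, x / (σ w / w) ∈ congr b π (r + 1) := by
  set m := x - 1 with hm
  have hmM : m ∈ latt b π r := hx
  have hx1 : x = 1 + m := by rw [hm]; ring
  -- `∑ σ^i m ∈ M_{2r+1}`, hence its `1`-coordinate, the coordinate sum of `m`, is small
  have hsum : ∑ i ∈ Finset.range n, (σ ^ i) m ∈ latt b π (r + 1) := by
    have h1 := galNorm_one_add_sub_mem_latt (σ := σ) hb hmul hπ.le hmM n
    rw [← hx1, hN, sub_add_eq_sub_sub, sub_self, zero_sub] at h1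
    exact latt_antitone hπ.le (by omega) ((neg_mem_iff).mp h1)
  have hs : ‖∑ g, b.repr m g‖ ≤ ‖π‖ ^ (r + 1) := by
    rw [← repr_sum_gal_one hb hσ m]; exact hsum 1
  obtain ⟨u, hu, hdiff⟩ := exists_gal_sub_sub_mem_latt hb hσ hmM hs
  refine ⟨1 + u, one_add_mem_congr_iff.mpr hu, ?_⟩
  have hw : (1 + u) ∈ congr b π r := one_add_mem_congr_iff.mpr hu
  have hσw : σ (1 + u) ∈ congr b π r := gal_apply_mem_congr hb σ hw
  rw [div_div_eq_mul_div]
  refine div_mem_congr_of_sub_mem hmul hπ hσw ?_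
  -- `x w - σ w = -((σu - u) - m) + m u`
  have : x * (1 + u) - σ (1 + u) = -((σ u - u) - m) + m * u := by
    rw [hx1, map_add, map_one]; ring
  rw [this]
  exact add_mem (neg_mem hdiff) (latt_antitone hπ.le (by omega) (mul_mem_latt hmul hmM hu))

/-- **Successive approximation** (Neukirch: "`a = (N_G b_0) a_1`, `a_1 = (N_G b_1) a_2`, …, this
yields `a = N_G b` with the convergent product `b = ∏ b_i`"): an abstract form for a multiplicative
self-map `Φ` of `L` preserving the `V_s`, a property `P`, and a one-step solvability hypothesis.
[cite: NeukirchANT1999, Ch. V §1 Thm. (1.1) (proof)] -/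
theorem exists_apply_eq_of_step [CompleteSpace K] (hmul : ∀ i j k, ‖b.repr (b i * b j) k‖ ≤ ‖π‖)
    (hπ : ‖π‖ < 1) (Φ : L → L) (hΦmul : ∀ x y, Φ (x * y) = Φ x * Φ y)
    (hΦV : ∀ s, ∀ w ∈ congr b π s, Φ w ∈ congr b π s) (P : L → Prop) {r : ℕ}
    (step : ∀ s, r ≤ s → ∀ x ∈ congr b π s, P x →
      ∃ w ∈ congr b π s, x / Φ w ∈ congr b π (s + 1) ∧ P (x / Φ w))
    {x : L} (hx : x ∈ congr b π r) (hPx : P x) : ∃ y ∈ congr b π r, Φ y = x := by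
  classical
  -- a choice function for the step
  have hch : ∀ (s : ℕ) (z : L), ∃ w : L, (r ≤ s ∧ z ∈ congr b π s ∧ P z) →
      (w ∈ congr b π s ∧ z / Φ w ∈ congr b π (s + 1) ∧ P (z / Φ w)) := by
    intro s z
    by_cases h : r ≤ s ∧ z ∈ congr b π s ∧ P z
    · obtain ⟨w, hw, h1, h2⟩ := step s h.1 z h.2.1 h.2.2
      exact ⟨w, fun _ => ⟨hw, h1, h2⟩⟩
    · exact ⟨1, fun h' => absurd h' h⟩
  choose W hW using hch
  -- the sequences
  let xs : ℕ → L := fun k => Nat.rec x (fun k z => z / Φ (W (r + k) z)) k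
  have hxs0 : xs 0 = x := rfl
  have hxss : ∀ k, xs (k + 1) = xs k / Φ (W (r + k) (xs k)) := fun k => rfl
  have hinv : ∀ k, xs k ∈ congr b π (r + k) ∧ P (xs k) := by
    intro k
    induction k with
    | zero => exact ⟨hx, hPx⟩
    | succ k ih =>
      have := hW (r + k) (xs k) ⟨by omega, ih.1, ih.2⟩
      rw [hxss, show r + (k + 1) = r + k + 1 by ring]
      exact ⟨this.2.1, this.2.2⟩
  let ws : ℕ → L := fun k => W (r + k) (xs k)
  have hwsV : ∀ k, ws k ∈ congr b π (r + k) := fun k =>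
    (hW (r + k) (xs k) ⟨by omega, (hinv k).1, (hinv k).2⟩).1
  have hws0 : ∀ k, ws k ≠ 0 := fun k => ne_zero_of_mem_congr hmul hπ (hwsV k)
  have hΦne : ∀ s, ∀ w ∈ congr b π s, Φ w ≠ 0 := fun s w hw =>
    ne_zero_of_mem_congr hmul hπ (hΦV s w hw)
  let ps : ℕ → L := fun k => ∏ j ∈ Finset.range k, ws j
  have hps_zero : ps 0 = 1 := Finset.prod_range_zero _
  have hps_succ : ∀ k, ps (k + 1) = ps k * ws k := fun k => Finset.prod_range_succ _ _
  have hpsV : ∀ k, ps k ∈ congr b π r := fun k =>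
    prod_mem_congr hmul hπ.le _ fun j _ => congr_antitone hπ.le (by omega) (hwsV j)
  have hΦ1 : Φ 1 = 1 := by
    have h := hΦmul 1 1
    rw [mul_one] at h
    have h1 : Φ 1 ≠ 0 := hΦne 0 1 (one_mem_congr 0)
    -- `Φ 1 = Φ 1 * Φ 1`
    calc Φ 1 = Φ 1 * Φ 1 / Φ 1 := by rw [mul_div_cancel_right₀ _ h1]
      _ = Φ 1 / Φ 1 := by rw [← h]
      _ = 1 := div_self h1
  -- `x = Φ (ps k) * xs k`
  have hrel : ∀ k, x = Φ (ps k) * xs k := by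
    intro k
    induction k with
    | zero => rw [hps_zero, hΦ1, one_mul, hxs0]
    | succ k ih =>
      rw [hps_succ, hΦmul, hxss, mul_assoc, mul_div_cancel₀ _ (hΦne _ _ (hwsV k))]
      exact ih
  -- the Cauchy property and the limit
  have hcauchy : ∀ k, ps (k + 1) - ps k ∈ latt b π (r + k) := fun k => by
    rw [hps_succ]
    exact mul_sub_mem_latt hmul hπ.le (hpsV k) (hwsV k)
  obtain ⟨y, hy⟩ := exists_forall_sub_mem_latt hπ hcauchy
  have hyV : y ∈ congr b π r := by
    have := hy 0
    rwa [hps_zero, add_zero] at this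
  refine ⟨y, hyV, ?_⟩
  have hy0 : y ≠ 0 := ne_zero_of_mem_congr hmul hπ hyV
  have hps0 : ∀ k, ps k ≠ 0 := fun k => ne_zero_of_mem_congr hmul hπ (hpsV k)
  -- `x / Φ y ∈ V_{r+k}` for every `k`
  have key : ∀ k, x / Φ y ∈ congr b π (r + k) := by
    intro k
    have hq : y / ps k ∈ congr b π (r + k) := div_mem_congr_of_sub_mem hmul hπ (hpsV k) (hy k)
    have hΦq : Φ (y / ps k) ∈ congr b π (r + k) := hΦV _ _ hq
    have hΦy : Φ y = Φ (y / ps k) * Φ (ps k) := by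
      rw [← hΦmul, div_mul_cancel₀ _ (hps0 k)]
    have : x / Φ y = xs k * (Φ (y / ps k))⁻¹ := by
      rw [hΦy, hrel k]
      field_simp [hΦne _ _ hq, hΦne _ _ (hpsV k)]
    rw [this]
    exact mul_mem_congr hmul hπ.le (hinv k).1 (inv_mem_congr hmul hπ hΦq)
  have h1 : x / Φ y - 1 = 0 :=
    eq_zero_of_forall_mem_latt hπ fun k => latt_antitone hπ.le (by omega : k ≤ r + k) (key k)
  rw [sub_eq_zero, div_eq_one_iff_eq (hΦne _ _ hyV)] at h1
  exact h1.symm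

/-- **`H⁰(G, V_r) = 1`**: every `σ`-fixed element of `V_r` is a norm from `V_r`.
[cite: NeukirchANT1999, Ch. V §1 Thm. (1.1) (proof)] -/
theorem exists_galNorm_eq [CompleteSpace K] [IsGalois K L] (hb : ∀ g : L ≃ₐ[K] L, b g = g (b 1))
    (hσ : ∀ τ : L ≃ₐ[K] L, τ ∈ Subgroup.zpowers σ)
    (hmul : ∀ i j k, ‖b.repr (b i * b j) k‖ ≤ ‖π‖) (hπ : ‖π‖ < 1) {r : ℕ} {x : L}
    (hx : x ∈ congr b π r) (hfix : σ x = x) : ∃ y ∈ congr b π r, galNorm σ n y = x := by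
  refine exists_apply_eq_of_step hmul hπ (galNorm σ n) (galNorm_mul σ n)
    (fun s w hw => galNorm_mem_congr hb hmul hπ.le hw _) (fun z => σ z = z) ?_ hx hfix
  intro s _ z hz hzfix
  obtain ⟨w, hw, h⟩ := exists_div_galNorm_mem_congr hb hσ hmul hπ hz hzfix
  exact ⟨w, hw, h, by rw [map_div₀, hzfix, gal_galNorm hσ]⟩

/-- **`H⁻¹(G, V_r) = 1`**: every norm-one element of `V_r` is `σy/y` with `y ∈ V_r`.
[cite: NeukirchANT1999, Ch. V §1 Thm. (1.1) (proof)] -/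
theorem exists_twist_eq [CompleteSpace K] [IsGalois K L] (hb : ∀ g : L ≃ₐ[K] L, b g = g (b 1))
    (hσ : ∀ τ : L ≃ₐ[K] L, τ ∈ Subgroup.zpowers σ)
    (hmul : ∀ i j k, ‖b.repr (b i * b j) k‖ ≤ ‖π‖) (hπ : ‖π‖ < 1) {r : ℕ} {x : L}
    (hx : x ∈ congr b π r) (hN : galNorm σ n x = 1) : ∃ y ∈ congr b π r, σ y / y = x := by
  refine exists_apply_eq_of_step hmul hπ (fun y => σ y / y) (fun x y => by
      rw [map_mul]; field_simp) ?_ (fun z => galNorm σ n z = 1) ?_ hx hN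
  · intro s w hw
    have hw0 := ne_zero_of_mem_congr hmul hπ hw
    have : σ w / w = σ w * w⁻¹ := div_eq_mul_inv _ _
    rw [this]
    exact mul_mem_congr hmul hπ.le (gal_apply_mem_congr hb σ hw) (inv_mem_congr hmul hπ hw)
  · intro s _ z hz hzN
    obtain ⟨w, hw, h⟩ := exists_div_twist_mem_congr hb hσ hmul hπ hz hzN
    refine ⟨w, hw, h, ?_⟩
    rw [galNorm_div, hzN, galNorm_div, galNorm_gal hσ, div_self, div_one]
    exact (galNorm_eq_zero_iff hσ).not.mpr (ne_zero_of_mem_congr hmul hπ hw)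

end Graded

/-! ### Topological input: `V_0` is open, `c^k ∈ V_0 ⇒ k = 0`, and `(Lˣ : V_0 · π^ℤ) < ∞` -/

section Normed

variable {K : Type*} [NontriviallyNormedField K] [CompleteSpace K] [IsUltrametricDist K]
variable {L : Type*} [Field L] [Algebra K L] [FiniteDimensional K L]
variable {ι : Type*} [Fintype ι] {b : Module.Basis ι K L} {π : K}

omit [Fintype ι] in
/-- The coordinate functions are continuous for the spectral norm on `L`. [folklore] -/
theorem continuous_repr_apply (i : ι) :
    letI := spectralNorm.nontriviallyNormedField K L
    Continuous fun x : L => b.repr x i := by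
  letI := spectralNorm.nontriviallyNormedField K L
  letI : NormedSpace K L := spectralNorm.normedSpace K L
  exact (b.coord i).continuous_of_finiteDimensional

/-- `M_0 = ⊕ 𝒪_K b_i` is open in `L` (Neukirch: "`M` is open"). [cite: NeukirchANT1999, Ch. V §1 Thm. (1.1) (proof)] -/
theorem isOpen_latt_zero :
    letI := spectralNorm.nontriviallyNormedField K L
    IsOpen (latt b π 0 : Set L) := by
  letI := spectralNorm.nontriviallyNormedField K L
  have : (latt b π 0 : Set L) = ⋂ i, (fun x : L => b.repr x i) ⁻¹' Metric.closedBall 0 1 := by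
    ext x
    simp only [SetLike.mem_coe, mem_latt_iff, pow_zero, Set.mem_iInter, Set.mem_preimage,
      Metric.mem_closedBall, dist_zero_right]
  rw [this]
  exact isOpen_iInter_of_finite fun i =>
    (IsUltrametricDist.isOpen_closedBall (0 : K) one_ne_zero).preimage (continuous_repr_apply i)

/-- `V_0 = 1 + M_0` is open in `L`. [cite: NeukirchANT1999, Ch. V §1 Thm. (1.1) (proof)] -/
theorem isOpen_congr_zero :
    letI := spectralNorm.nontriviallyNormedField K L
    IsOpen (congr b π 0) := by
  letI := spectralNorm.nontriviallyNormedField K L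
  exact isOpen_latt_zero.preimage (continuous_id.sub continuous_const)

/-- Elements of `M_0` are small when the basis vectors are: `‖x‖ < 1`. [folklore] -/
theorem norm_lt_one_of_mem_latt_zero [Nonempty ι]
    (hsmall : letI := spectralNorm.nontriviallyNormedField K L; ∀ i, ‖b i‖ < 1) {x : L}
    (hx : x ∈ latt b π 0) :
    letI := spectralNorm.nontriviallyNormedField K L
    ‖x‖ < 1 := by
  letI := spectralNorm.nontriviallyNormedField K L
  letI : NormedSpace K L := spectralNorm.normedSpace K L
  haveI : IsUltrametricDist L := IsUltrametricDist.isUltrametricDist_of_forall_norm_add_le_max_norm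
    (fun a b => isNonarchimedean_spectralNorm (K := K) (L := L) a b)
  obtain ⟨i₀, hi₀⟩ := Finite.exists_max fun i => ‖b i‖
  rw [← b.sum_repr x]
  refine lt_of_le_of_lt (IsUltrametricDist.norm_sum_le_of_forall_le_of_nonneg (norm_nonneg (b i₀))
    fun i _ => ?_) (hsmall i₀)
  rw [norm_smul]
  have h1 : ‖b.repr x i‖ ≤ 1 := by simpa using hx i
  calc ‖b.repr x i‖ * ‖b i‖ ≤ 1 * ‖b i‖ := by gcongr
    _ = ‖b i‖ := one_mul _
    _ ≤ ‖b i₀‖ := hi₀ i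

/-- **`c^k ∈ V_0` forces `k = 0`** for `c = π` (`0 < ‖π‖ < 1`): elements of `V_0` have absolute
value `1`. [cite: NeukirchANT1999, Ch. V §1 Thm. (1.1) (proof)] -/
theorem zpow_mem_congr_zero_imp [Nonempty ι] (hπ0 : 0 < ‖π‖) (hπ : ‖π‖ < 1)
    (hsmall : letI := spectralNorm.nontriviallyNormedField K L; ∀ i, ‖b i‖ < 1) {k : ℤ}
    (hk : algebraMap K L (π ^ k) ∈ congr b π 0) : k = 0 := by
  letI := spectralNorm.nontriviallyNormedField K L
  haveI : IsUltrametricDist L := IsUltrametricDist.isUltrametricDist_of_forall_norm_add_le_max_norm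
    (fun a b => isNonarchimedean_spectralNorm (K := K) (L := L) a b)
  have h1 : ‖algebraMap K L (π ^ k) - 1‖ < 1 := norm_lt_one_of_mem_latt_zero hsmall hk
  have h2 : ‖algebraMap K L (π ^ k)‖ = 1 := by
    have : algebraMap K L (π ^ k) = (algebraMap K L (π ^ k) - 1) + 1 := by ring
    rw [this, IsUltrametricDist.norm_add_eq_max_of_norm_ne_norm, norm_one, max_eq_right h1.le]
    rw [norm_one]; exact h1.ne
  rw [show ‖algebraMap K L (π ^ k)‖ = spectralNorm K L (algebraMap K L (π ^ k)) from rfl,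
    spectralNorm_extends, norm_zpow] at h2
  have h3 : ‖π‖ ^ k = ‖π‖ ^ (0 : ℤ) := by rw [h2, zpow_zero]
  exact zpow_right_injective₀ hπ0 hπ.ne h3

/-- **`(Lˣ : V_0 · π^ℤ) < ∞`.**  Neukirch: `U_L/Vⁿ` is finite (`U_L` compact, `Vⁿ` open) and
`Lˣ/U_L ≅ ℤ`; here: the absolute values of `Lˣ` satisfy `‖y‖^{nd} ∈ ρ^ℤ` when those of `Kˣ`
satisfy `‖x‖^d ∈ ρ^ℤ` (`‖y‖^n = ‖N y‖`), so finitely many "spheres" meet every class modulo `π^ℤ`,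
each a translate of the compact unit sphere, which finitely many translates of the open `V_0`
cover. [cite: NeukirchANT1999, Ch. V §1 Thm. (1.1) (proof)] -/
theorem finite_quotient_congrUnits_sup [LocallyCompactSpace K]
    (hmul : ∀ i j k, ‖b.repr (b i * b j) k‖ ≤ ‖π‖) (hπ0 : 0 < ‖π‖) (hπ : ‖π‖ < 1)
    (hK : ∃ (ρ : ℝ) (d : ℕ), 0 < ρ ∧ ρ < 1 ∧ 0 < d ∧ ∀ x : K, x ≠ 0 → ∃ k : ℤ, ‖x‖ ^ d = ρ ^ k) :
    Finite (Lˣ ⧸ (congrUnits b π hmul hπ 0 ⊔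
      Subgroup.zpowers (unitsIncl K L (Units.mk0 π (norm_pos_iff.mp hπ0))))) := by
  classical
  letI := spectralNorm.nontriviallyNormedField K L
  letI : NormedSpace K L := spectralNorm.normedSpace K L
  set Φ := congrUnits b π hmul hπ 0 ⊔
    Subgroup.zpowers (unitsIncl K L (Units.mk0 π (norm_pos_iff.mp hπ0))) with hΦ
  set πu : Kˣ := Units.mk0 π (norm_pos_iff.mp hπ0) with hπu
  have hnorm : ∀ y : L, ‖y‖ = spectralNorm K L y := fun _ => rfl
  -- Step B: finitely many translates of `V_0` cover the unit sphere
  set S : Set L := Metric.sphere (0 : L) 1 with hS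
  have hScpt : IsCompact S := isCompact_sphere_spectralNorm K L
  have hS0 : ∀ u ∈ S, u ≠ 0 := fun u hu h0 => by
    rw [h0, hS, Metric.mem_sphere, dist_zero_right, norm_zero] at hu
    exact zero_ne_one hu
  set W : S → Set L := fun u => (fun y : L => y / (u : L)) ⁻¹' congr b π 0 with hW
  have hWo : ∀ u, IsOpen (W u) := fun u =>
    isOpen_congr_zero.preimage (continuous_id.div_const _)
  have hcover : S ⊆ ⋃ u, W u := fun u hu =>
    Set.mem_iUnion.mpr ⟨⟨u, hu⟩, by
      change u / u ∈ congr b π 0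
      rw [div_self (hS0 u hu)]; exact one_mem_congr 0⟩
  obtain ⟨t, ht⟩ := hScpt.elim_finite_subcover W hWo hcover
  -- Step A: the absolute values of `Lˣ`
  obtain ⟨ρ, d, hρ0, hρ1, hd, hval⟩ := hK
  set n := Module.finrank K L with hn
  have hn0 : 0 < n := Module.finrank_pos
  have hLval : ∀ y : L, y ≠ 0 → ∃ j : ℤ, ‖y‖ ^ (n * d) = ρ ^ j := fun y hy => by
    obtain ⟨j, hj⟩ := hval (Algebra.norm K y) (Algebra.norm_ne_zero_iff.mpr hy)
    refine ⟨j, ?_⟩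
    rw [pow_mul, hnorm, ← norm_algebraNorm_eq_spectralNorm_pow K L y, hj]
  obtain ⟨a, ha⟩ := hval π (norm_pos_iff.mp hπ0)
  have ha0 : 0 < a := by
    have : ρ ^ a < 1 := by rw [← ha]; exact pow_lt_one₀ (norm_nonneg _) hπ hd.ne'
    rwa [zpow_lt_one_iff_right_of_lt_one₀ hρ0 hρ1] at this
  set A : ℕ := n * a.toNat with hA
  have hAa : (A : ℤ) = n * a := by rw [hA]; push_cast; rw [Int.toNat_of_nonneg ha0.le]
  have hA0 : 0 < A := Nat.mul_pos hn0 (by omega)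
  have hπL : ∀ q : ℤ, ‖algebraMap K L π ^ q‖ ^ (n * d) = ρ ^ ((A : ℤ) * q) := fun q => by
    rw [norm_zpow, hnorm, spectralNorm_extends, ← zpow_natCast (‖π‖ ^ q), ← zpow_mul,
      show q * ((n * d : ℕ) : ℤ) = (d : ℤ) * (q * n) by push_cast; ring,
      zpow_mul, zpow_natCast, ha, ← zpow_mul, hAa]
    congr 1
    ring
  -- representatives of the finitely many non-empty spheres `‖z‖^{nd} = ρ^s`, `s < A`
  have hrep : ∀ s : ℕ, ∃ z : L, (∃ z' : L, z' ≠ 0 ∧ ‖z'‖ ^ (n * d) = ρ ^ (s : ℤ)) →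
      (z ≠ 0 ∧ ‖z‖ ^ (n * d) = ρ ^ (s : ℤ)) := fun s => by
    by_cases h : ∃ z' : L, z' ≠ 0 ∧ ‖z'‖ ^ (n * d) = ρ ^ (s : ℤ)
    · obtain ⟨z', hz'⟩ := h; exact ⟨z', fun _ => hz'⟩
    · exact ⟨1, fun h' => absurd h' h⟩
  choose zrep hzrep using hrep
  -- the surjection `t × Fin A → Lˣ ⧸ Φ`
  have hπΦ : ∀ q : ℤ, unitsIncl K L πu ^ q ∈ Φ := fun q =>
    Subgroup.mem_sup_right (Subgroup.zpow_mem_zpowers _ _)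
  let f : t × Fin A → Lˣ ⧸ Φ := fun p =>
    if h : ((p.1 : S) : L) * zrep p.2 ≠ 0 then QuotientGroup.mk (Units.mk0 _ h) else 1
  haveI : Finite (t × Fin A) := inferInstance
  refine Finite.of_surjective f fun q => ?_
  obtain ⟨y, rfl⟩ := QuotientGroup.mk_surjective q
  have hy0 : (y : L) ≠ 0 := y.ne_zero
  obtain ⟨j, hj⟩ := hLval y hy0
  -- `z = y π^{-q}` has `‖z‖^{nd} = ρ^s`, `s = j mod A`
  set qq : ℤ := j / A with hqq
  set s : ℤ := j % A with hs
  have hs0 : 0 ≤ s := Int.emod_nonneg _ (by exact_mod_cast hA0.ne')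
  have hsA : s < A := Int.emod_lt_of_pos _ (by exact_mod_cast hA0)
  have hjqs : j = s + A * qq := (Int.emod_add_mul_ediv j A).symm
  set z : L := (y : L) * (algebraMap K L π ^ qq)⁻¹ with hz
  have hπq0 : algebraMap K L π ^ qq ≠ 0 := zpow_ne_zero _ ((map_ne_zero _).mpr (norm_pos_iff.mp hπ0))
  have hz0 : z ≠ 0 := mul_ne_zero hy0 (inv_ne_zero hπq0)
  have hzval : ‖z‖ ^ (n * d) = ρ ^ s := by
    have h1 : ‖z‖ ^ (n * d) * ‖algebraMap K L π ^ qq‖ ^ (n * d) = ‖(y : L)‖ ^ (n * d) := by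
      rw [← mul_pow, ← norm_mul, hz, inv_mul_cancel_right₀ hπq0]
    rw [hπL, hj, hjqs, zpow_add₀ hρ0.ne'] at h1
    exact mul_right_cancel₀ (zpow_ne_zero _ hρ0.ne') h1
  -- so `z / zrep s` is on the unit sphere, hence in some `W v`, `v ∈ t`
  set sN : Fin A := ⟨s.toNat, by omega⟩ with hsN
  have hsNs : ((sN : ℕ) : ℤ) = s := by simp [hsN, Int.toNat_of_nonneg hs0]
  have hzr := hzrep sN ⟨z, hz0, by rw [hsNs]; exact hzval⟩
  have hu : z / zrep sN ∈ S := by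
    rw [hS, Metric.mem_sphere, dist_zero_right, norm_div]
    have : ‖z‖ = ‖zrep sN‖ := by
      have h1 : ‖z‖ ^ (n * d) = ‖zrep sN‖ ^ (n * d) := by rw [hzval, hzr.2, hsNs]
      exact (pow_left_inj₀ (norm_nonneg _) (norm_nonneg _) (Nat.mul_pos hn0 hd).ne').mp h1
    rw [this, div_self (norm_ne_zero_iff.mpr hzr.1)]
  obtain ⟨v, hvt, hv⟩ : ∃ v ∈ t, z / zrep sN ∈ W v := by
    have := ht hu
    simp only [Set.mem_iUnion] at this
    obtain ⟨v, hvt, hv⟩ := this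
    exact ⟨v, hvt, hv⟩
  change z / zrep sN / (v : L) ∈ congr b π 0 at hv
  have hv0 : ((v : S) : L) ≠ 0 := hS0 _ v.2
  refine ⟨(⟨v, hvt⟩, sN), ?_⟩
  have hne : ((v : S) : L) * zrep sN ≠ 0 := mul_ne_zero hv0 hzr.1
  simp only [f, dif_pos hne]
  apply QuotientGroup.eq.mpr
  -- `(v zrep_s)⁻¹ y = (z / zrep_s / v) · π^q ∈ V_0 · π^ℤ`
  have hw0 := ne_zero_of_mem_congr hmul hπ hv
  have key : (Units.mk0 _ hne)⁻¹ * y = Units.mk0 _ hw0 * unitsIncl K L πu ^ qq := by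
    ext
    simp only [Units.val_mul, Units.val_inv_eq_inv_val, Units.val_mk0, Units.val_zpow_eq_zpow_val,
      coe_unitsIncl, hπu]
    rw [hz]
    field_simp
  rw [key]
  exact Subgroup.mul_mem _ (Subgroup.mem_sup_left hv) (hπΦ qq)

/-- **Scaling the normal basis.**  Multiplying a basis of normal shape by `π^t`, `t ≫ 0`, gives a
basis of normal shape with structure constants in `π𝒪_K` and all vectors of absolute value `< 1`
(Neukirch: "`α ∈ 𝒪_L`", "`π_K^N 𝒪_L ⊆ M`", `n ≥ N`). [cite: NeukirchANT1999, Ch. V §1 Thm. (1.1) (proof)] -/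
theorem exists_scaled_normal_basis (hπ0 : 0 < ‖π‖) (hπ : ‖π‖ < 1)
    (b₀ : Module.Basis (L ≃ₐ[K] L) K L) (hb₀ : ∀ g, b₀ g = g (b₀ 1)) :
    ∃ b : Module.Basis (L ≃ₐ[K] L) K L, (∀ g, b g = g (b 1)) ∧
      (∀ i j k, ‖b.repr (b i * b j) k‖ ≤ ‖π‖) ∧
      (letI := spectralNorm.nontriviallyNormedField K L; ∀ i, ‖b i‖ < 1) := by
  letI := spectralNorm.nontriviallyNormedField K L
  letI : NormedSpace K L := spectralNorm.normedSpace K L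
  -- bounds
  obtain ⟨C, hC⟩ : ∃ C : ℝ, 0 ≤ C ∧ ∀ p : (L ≃ₐ[K] L) × (L ≃ₐ[K] L) × (L ≃ₐ[K] L),
      ‖b₀.repr (b₀ p.1 * b₀ p.2.1) p.2.2‖ ≤ C := by
    obtain ⟨C, hC⟩ := (Set.finite_range fun p : (L ≃ₐ[K] L) × (L ≃ₐ[K] L) × (L ≃ₐ[K] L) =>
      ‖b₀.repr (b₀ p.1 * b₀ p.2.1) p.2.2‖).bddAbove
    exact ⟨max C 0, le_max_right _ _, fun p => (hC ⟨p, rfl⟩).trans (le_max_left _ _)⟩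
  obtain ⟨B, hB⟩ : ∃ B : ℝ, 0 ≤ B ∧ ∀ i, ‖b₀ i‖ ≤ B := by
    obtain ⟨B, hB⟩ := (Set.finite_range fun i : L ≃ₐ[K] L => ‖b₀ i‖).bddAbove
    exact ⟨max B 0, le_max_right _ _, fun i => (hB ⟨i, rfl⟩).trans (le_max_left _ _)⟩
  obtain ⟨t₁, ht₁⟩ := exists_pow_lt_of_lt_one (div_pos hπ0 (by linarith : (0:ℝ) < C + 1)) hπ
  obtain ⟨t₂, ht₂⟩ := exists_pow_lt_of_lt_one (div_pos one_pos (by linarith : (0:ℝ) < B + 1)) hπ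
  set t := t₁ + t₂ with ht
  have hπt : ‖π‖ ^ t ≤ ‖π‖ ^ t₁ := pow_le_pow_of_le_one hπ0.le hπ.le (by omega)
  have hπt' : ‖π‖ ^ t ≤ ‖π‖ ^ t₂ := pow_le_pow_of_le_one hπ0.le hπ.le (by omega)
  have hπne : π ≠ 0 := norm_pos_iff.mp hπ0
  set w : (L ≃ₐ[K] L) → Kˣ := fun _ => Units.mk0 (π ^ t) (pow_ne_zero _ hπne) with hw
  refine ⟨b₀.unitsSMul w, ?_, ?_, ?_⟩
  · intro g
    rw [Module.Basis.unitsSMul_apply, Module.Basis.unitsSMul_apply, hb₀ g, Units.smul_def,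
      Units.smul_def, map_smul]
  · intro i j k
    rw [Module.Basis.repr_unitsSMul, Module.Basis.unitsSMul_apply, Module.Basis.unitsSMul_apply,
      Units.smul_def, Units.smul_def, Units.smul_def, smul_mul_smul_comm, map_smul,
      Finsupp.smul_apply, smul_eq_mul, smul_eq_mul]
    simp only [hw, Units.val_inv_eq_inv_val, Units.val_mk0]
    rw [show (π ^ t)⁻¹ * (π ^ t * π ^ t * b₀.repr (b₀ i * b₀ j) k) = π ^ t * b₀.repr (b₀ i * b₀ j) k
      by field_simp]
    rw [norm_mul, norm_pow]
    calc ‖π‖ ^ t * ‖b₀.repr (b₀ i * b₀ j) k‖ ≤ ‖π‖ ^ t₁ * C :=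
          mul_le_mul hπt (hC.2 ⟨i, j, k⟩) (norm_nonneg _) (by positivity)
      _ ≤ ‖π‖ ^ t₁ * (C + 1) := by gcongr; linarith
      _ ≤ ‖π‖ := by
          have := (lt_div_iff₀ (by linarith : (0:ℝ) < C + 1)).mp ht₁
          exact this.le
  · intro i
    rw [Module.Basis.unitsSMul_apply, Units.smul_def, norm_smul]
    simp only [hw, Units.val_mk0, norm_pow]
    calc ‖π‖ ^ t * ‖b₀ i‖ ≤ ‖π‖ ^ t₂ * B := mul_le_mul hπt' (hB.2 i) (norm_nonneg _) (by positivity)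
      _ < 1 := by
          have h1 := (lt_div_iff₀ (by linarith : (0:ℝ) < B + 1)).mp ht₂
          calc ‖π‖ ^ t₂ * B ≤ ‖π‖ ^ t₂ * (B + 1) := by gcongr; linarith
            _ < 1 := h1

end Normed

/-! ### Assembly over a complete discretely valued locally compact ultrametric field -/

section Assembly

variable (K : Type*) [NontriviallyNormedField K] [CompleteSpace K] [IsUltrametricDist K]
  [LocallyCompactSpace K]
variable (L : Type*) [Field L] [Algebra K L] [FiniteDimensional K L] [IsGalois K L]

/-- **Neukirch V (1.1), `i = 0`, normed form.**  Let `K` be a complete, locally compact,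
ultrametric normed field whose absolute values satisfy `‖x‖^d ∈ ρ^ℤ` for some `0 < ρ < 1`, `d ≥ 1`
(e.g. a non-archimedean local field, `d = 1`, `ρ = ‖π‖`; or a finite extension of one with the
spectral norm), and `L/K` finite Galois with cyclic group.  Then `(Kˣ : N_{L/K} Lˣ) = [L : K]`.
Proof: Neukirch's — `V = 1 + M`, `M = ⊕ 𝒪_K π^t σ(α)` for a normal basis `{σ(α)}` and `t ≫ 0`, is
`σ`-stable and cohomologically trivial (`exists_galNorm_eq`, `exists_twist_eq`), `V ∩ π^ℤ = 1`,
`(Lˣ : V π^ℤ) < ∞`, and the reduction theorem `CyclicNormIndex.index_range_norm_eq_finrank`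
(Herbrand quotient + Hilbert 90) applies. [cite: NeukirchANT1999, Ch. V §1 Thm. (1.1)] -/
theorem index_range_norm_eq_finrank_of_normed
    (hK : ∃ (ρ : ℝ) (d : ℕ), 0 < ρ ∧ ρ < 1 ∧ 0 < d ∧ ∀ x : K, x ≠ 0 → ∃ k : ℤ, ‖x‖ ^ d = ρ ^ k)
    [IsCyclic (L ≃ₐ[K] L)] :
    (Units.map (Algebra.norm K : L →* K)).range.index = Module.finrank K L := by
  classical
  obtain ⟨σ, hσ⟩ := IsCyclic.exists_generator (α := L ≃ₐ[K] L)
  -- a small element `π`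
  obtain ⟨x, hx⟩ := NormedField.exists_one_lt_norm K
  set π : K := x⁻¹ with hπdef
  have hx0 : x ≠ 0 := norm_pos_iff.mp (zero_lt_one.trans hx)
  have hπ0 : 0 < ‖π‖ := by rw [hπdef, norm_inv]; exact inv_pos.mpr (zero_lt_one.trans hx)
  have hπ : ‖π‖ < 1 := by rw [hπdef, norm_inv]; exact inv_lt_one_of_one_lt₀ hx
  have hπne : π ≠ 0 := norm_pos_iff.mp hπ0
  -- the scaled normal basis and `V = V_0`
  obtain ⟨b, hb, hmul, hsmall⟩ := exists_scaled_normal_basis (K := K) (L := L) hπ0 hπ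
    (IsGalois.normalBasis K L) (fun g => IsGalois.normalBasis_apply g)
  set V : Subgroup Lˣ := congrUnits b π hmul hπ 0 with hV
  set c : Kˣ := Units.mk0 π hπne with hc
  have hVmem : ∀ u : Lˣ, u ∈ V ↔ (u : L) ∈ congr b π 0 := fun u => Iff.rfl
  refine CyclicNormIndex.index_range_norm_eq_finrank hσ V c ?hV ?hc ?h0 ?h1 ?hfin
  · -- `σ`-stable
    intro u hu
    rw [hVmem] at hu ⊢
    exact gal_apply_mem_congr hb σ hu
  · -- `c^k ∈ V ⇒ k = 0`
    intro k hk
    rw [hVmem, Units.val_zpow_eq_zpow_val, coe_unitsIncl, hc, Units.val_mk0, ← map_zpow₀] at hk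
    exact zpow_mem_congr_zero_imp hπ0 hπ hsmall hk
  · -- `H⁰(G, V) = 1`
    intro u hu hfix
    have hfix' : σ (u : L) = u := by
      have := congrArg Units.val hfix
      rwa [coe_smul_units] at this
    obtain ⟨y, hy, hyu⟩ := exists_galNorm_eq hb hσ hmul hπ ((hVmem u).mp hu) hfix'
    refine ⟨Units.mk0 y (ne_zero_of_mem_congr hmul hπ hy), hy, Units.ext ?_⟩
    rw [coe_normEnd_apply, Units.val_mk0]
    exact hyu
  · -- `H⁻¹(G, V) = 1`
    intro u hu hN
    have hN' : galNorm σ (Nat.card (L ≃ₐ[K] L)) (u : L) = 1 := by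
      have := congrArg Units.val hN
      rwa [coe_normEnd_apply] at this
    obtain ⟨y, hy, hyu⟩ := exists_twist_eq hb hσ hmul hπ ((hVmem u).mp hu) hN'
    refine ⟨Units.mk0 y (ne_zero_of_mem_congr hmul hπ hy), hy, Units.ext ?_⟩
    rw [twistEnd_apply, Units.val_div_eq_div_val, coe_smul_units, Units.val_mk0]
    exact hyu
  · -- finite index
    haveI := finite_quotient_congrUnits_sup (b := b) hmul hπ0 hπ hK
    exact Subgroup.finiteIndex_of_finite_quotient

end Assembly

end CyclicNormIndex

/-! ### The class field axiom for non-archimedean local fields -/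

section LocalField

open ValuativeRel

variable (K : Type*) [Field K] [ValuativeRel K] [TopologicalSpace K] [IsNonarchimedeanLocalField K]
variable (L : Type*) [Field L] [Algebra K L] [FiniteDimensional K L] [IsGalois K L]

/-- **The class field axiom for local fields, `H⁰` part (Neukirch V (1.1), `i = 0`): for a
non-archimedean local field `K` and a finite cyclic extension `L/K`,
`#H⁰(G(L|K), L*) = (Kˣ : N_{L/K} Lˣ) = [L : K]`.** [cite: NeukirchANT1999, Ch. V §1 Thm. (1.1)] -/
theorem index_range_unitsMap_norm_eq_finrank [IsCyclic (L ≃ₐ[K] L)] :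
    (Units.map (Algebra.norm K : L →* K)).range.index = Module.finrank K L := by
  classical
  letI : UniformSpace K := IsTopologicalAddGroup.rightUniformSpace K
  haveI : IsUniformAddGroup K := isUniformAddGroup_of_addCommGroup
  letI hv1 : (Valued.v (R := K)).RankOne :=
  { hom' := IsRankLeOne.nonempty.some.emb (R := K).comp MonoidWithZeroHom.ValueGroup₀.embedding
    strictMono' := IsRankLeOne.nonempty.some.strictMono.comp
        MonoidWithZeroHom.ValueGroup₀.embedding_strictMono }
  letI hNF : NontriviallyNormedField K := Valued.toNontriviallyNormedField K (ValueGroupWithZero K)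
  have heqeq : ∀ y y' : K, ‖y‖ = ‖y'‖ ↔ valuation K y = valuation K y' := fun y y' => by
    have hlele : ∀ y y' : K, ‖y‖ ≤ ‖y'‖ ↔ valuation K y ≤ valuation K y' := fun y y' => by
      rw [Valued.toNormedField.norm_le_iff]; rfl
    rw [le_antisymm_iff, le_antisymm_iff, hlele, hlele]
  have hlt : ∀ y : K, ‖y‖ < 1 ↔ valuation K y < 1 := fun y => by
    rw [Valued.toNormedField.norm_lt_one_iff]; rfl
  -- discreteness: `‖x‖ = ‖π‖^k`
  obtain ⟨π, hπ⟩ := exists_isUniformizer K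
  have hπ1 : ‖(π : K)‖ < 1 := (hlt _).mpr hπ.val_lt_one
  have hπ0 : 0 < ‖(π : K)‖ := norm_pos_iff.mpr π.ne_zero
  have hK : ∃ (ρ : ℝ) (d : ℕ), 0 < ρ ∧ ρ < 1 ∧ 0 < d ∧ ∀ x : K, x ≠ 0 → ∃ k : ℤ, ‖x‖ ^ d = ρ ^ k := by
    refine ⟨‖(π : K)‖, 1, hπ0, hπ1, one_pos, fun x hx => ?_⟩
    obtain ⟨k, hk⟩ := exists_valuation_eq_unifValue_zpow K hx
    refine ⟨k, ?_⟩
    rw [pow_one, ← norm_zpow, heqeq, hk, map_zpow₀,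
      (isUniformizer_iff_valuation_eq_unifValue K _).mp hπ]
  exact CyclicNormIndex.index_range_norm_eq_finrank_of_normed K L hK

omit [ValuativeRel K] [TopologicalSpace K] [IsNonarchimedeanLocalField K] in
/-- **The class field axiom for local fields, `H⁻¹` part (Neukirch V (1.1), `i = -1` = Hilbert 90):
for `L/K` finite Galois with group generated by `σ` (any field `K`), an element of norm `1` is
`σ(y)/y`.** [cite: NeukirchANT1999, Ch. V §1 Thm. (1.1); Ch. IV §3 Thm. (3.5)] -/
theorem exists_eq_apply_div_of_norm_eq_one {σ : L ≃ₐ[K] L}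
    (hσ : ∀ τ : L ≃ₐ[K] L, τ ∈ Subgroup.zpowers σ) {x : L} (hx : Algebra.norm K x = 1) :
    ∃ y : L, y ≠ 0 ∧ x = σ y / y :=
  CyclicNormIndex.exists_eq_div_of_norm_eq_one hσ hx

/-- **The cyclic case of the local fundamental equality** `index_normSubgroup_eq_finrank`
(`LocalExistenceTheorem.lean`, Serre XIII §4 Prop. 9 for abelian `E/F`): for finite *cyclic*
`E ⊆ F̄` over a non-archimedean local field `F`, `[Fˣ : N_{E/F}(Eˣ)] = [E : F]` — proved.
[cite: NeukirchANT1999, Ch. V §1 Thm. (1.1)] -/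
theorem index_range_norm_eq_finrank_of_isCyclic (E : IntermediateField K (AlgebraicClosure K))
    [FiniteDimensional K E] [IsGalois K E] [IsCyclic (E ≃ₐ[K] E)] :
    (Units.map (Algebra.norm K : E →* K)).range.index = Module.finrank K E :=
  index_range_unitsMap_norm_eq_finrank K E

end LocalField

/-! ### Discharge of the named fact `LocalWeilDatum.cyclicNormIndexEq` (Neukirch V (1.1), `i = 0`) -/

namespace LocalWeilDatum

open ValuativeRel

variable (F : Type*) [Field F] [ValuativeRel F] [TopologicalSpace F] [IsNonarchimedeanLocalField F]

/-- **Neukirch V (1.1), `i = 0`, for the finite separable subextensions `K ≤ L` of `F̄` over a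
non-archimedean local field `F`** — the named fact `LocalWeilDatum.cyclicNormIndexEq F` of
`LocalWeilDatumRelative.lean` holds.  `K` is given the spectral norm over `F` (complete, locally
compact, ultrametric, with `‖x‖^{[K:F]} = ‖N_{K/F} x‖ ∈ ‖π_F‖^ℤ`), and
`CyclicNormIndex.index_range_norm_eq_finrank_of_normed` applies to `L/K`.
[cite: NeukirchANT1999, Ch. V §1 Thm. (1.1)] -/
theorem cyclicNormIndexEq_holds : cyclicNormIndexEq F := by
  intro K L _ hKL _
  letI := towerAlgebra hKL
  intro _ _
  classical
  haveI := towerAlgebra_finiteDimensional hKL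
  haveI : FiniteDimensional F K := Module.Finite.of_injective
    (IntermediateField.inclusion hKL).toLinearMap (IntermediateField.inclusion hKL).toRingHom.injective
  -- the norm on `F`
  letI : UniformSpace F := IsTopologicalAddGroup.rightUniformSpace F
  haveI : IsUniformAddGroup F := isUniformAddGroup_of_addCommGroup
  letI hv1 : (Valued.v (R := F)).RankOne :=
  { hom' := IsRankLeOne.nonempty.some.emb (R := F).comp MonoidWithZeroHom.ValueGroup₀.embedding
    strictMono' := IsRankLeOne.nonempty.some.strictMono.comp
        MonoidWithZeroHom.ValueGroup₀.embedding_strictMono }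
  letI hNF : NontriviallyNormedField F := Valued.toNontriviallyNormedField F (ValueGroupWithZero F)
  have heqeq : ∀ y y' : F, ‖y‖ = ‖y'‖ ↔ valuation F y = valuation F y' := fun y y' => by
    have hlele : ∀ y y' : F, ‖y‖ ≤ ‖y'‖ ↔ valuation F y ≤ valuation F y' := fun y y' => by
      rw [Valued.toNormedField.norm_le_iff]; rfl
    rw [le_antisymm_iff, le_antisymm_iff, hlele, hlele]
  have hlt : ∀ y : F, ‖y‖ < 1 ↔ valuation F y < 1 := fun y => by
    rw [Valued.toNormedField.norm_lt_one_iff]; rfl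
  obtain ⟨π, hπ⟩ := exists_isUniformizer F
  have hπ1 : ‖(π : F)‖ < 1 := (hlt _).mpr hπ.val_lt_one
  have hπ0 : 0 < ‖(π : F)‖ := norm_pos_iff.mpr π.ne_zero
  have hvalF : ∀ x : F, x ≠ 0 → ∃ k : ℤ, ‖x‖ = ‖(π : F)‖ ^ k := fun x hx => by
    obtain ⟨k, hk⟩ := exists_valuation_eq_unifValue_zpow F hx
    refine ⟨k, ?_⟩
    rw [← norm_zpow, heqeq, hk, map_zpow₀, (isUniformizer_iff_valuation_eq_unifValue F _).mp hπ]
  -- the spectral norm on `K`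
  letI hNK : NontriviallyNormedField K := spectralNorm.nontriviallyNormedField F K
  letI : NormedSpace F K := spectralNorm.normedSpace F K
  haveI : IsUltrametricDist K := IsUltrametricDist.isUltrametricDist_of_forall_norm_add_le_max_norm
    (fun a b => isNonarchimedean_spectralNorm (K := F) (L := K) a b)
  haveI : ProperSpace K := FiniteDimensional.proper F K
  have hK : ∃ (ρ : ℝ) (d : ℕ), 0 < ρ ∧ ρ < 1 ∧ 0 < d ∧ ∀ x : K, x ≠ 0 → ∃ k : ℤ, ‖x‖ ^ d = ρ ^ k := by
    refine ⟨‖(π : F)‖, Module.finrank F K, hπ0, hπ1, Module.finrank_pos, fun x hx => ?_⟩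
    obtain ⟨k, hk⟩ := hvalF (Algebra.norm F x) (Algebra.norm_ne_zero_iff.mpr hx)
    refine ⟨k, ?_⟩
    rw [← hk, norm_algebraNorm_eq_spectralNorm_pow F K x]
    rfl
  exact CyclicNormIndex.index_range_norm_eq_finrank_of_normed K L hK

end LocalWeilDatum

end Literature.NumberTheory.GaloisRepresentations
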